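import Literature.NumberTheory.Sieve.FriedlanderIwaniecPrimesCutoffSeparation
import Literature.NumberTheory.Sieve.FriedlanderIwaniecSpinTheorem2Psi
import Literature.NumberTheory.Sieve.FriedlanderIwaniecPrimesSeparationIdentity
import Literature.NumberTheory.Sieve.AsymptoticSieveForPrimes
import Mathlib.NumberTheory.Chebyshev
import HarnessLib

/-!
# Friedlander–Iwaniec, *The polynomial `X² + Y⁴` captures its primes*, §25: the pieces `T(c, 𝔡)`, `T(c)`, `S(c)` and the middle range of the reduction of Proposition 17.2

Family `parity` (Line A of the FI `a² + b⁴` completion, node (vi): Propositions 17.2–17.3, the bound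
for `W(β)`). Source: J. Friedlander, H. Iwaniec, Ann. of Math. (2) 148 (1998), 945–1040
[FriedlanderIwaniecAnnals1998] (= arXiv:math/9811185), §25 "Estimation of `S^k_χ(β')`" (arXiv
pp. 83–84): "Recalling (17.14), (17.15) and (23.1) we write (25.1)
`S^k_χ(β') = Σ_{(m,Π)=1} g(m) μ(m) γ(m) λ(m)` where `g(m)` is a smooth function supported on
`N' ≤ m ≤ (1+θ)N'` … (25.2) `γ(m) = Σ_{c∣m, c≤C} μ(c)` with `1 ≤ C ≤ N^{1-η}` … Therefore, changing the
order of summation, `S^k_χ(β') = Σ♭_{c ≤ C, (c,Π)=1} Σ_{(ℓ,cΠ)=1} μ(ℓ) g(cℓ) λ(cℓ)`. First we can assume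
that (25.3) `1 ≤ C ≤ N^η` because the remaining partial sum … with `N^η < c ≤ N^{1-η}` is a bilinear
form of type `ℒ*(A, B)` … for which Proposition 23.1 gives the bound (25.4) … Now we decompose the
inner sum over `ℓ` according to the formula (24.13) with `x = N` getting
`S^k_χ(β') = Σ♭_{c} {Σ_{𝔡 ≤ N^{2/r}} T(c, 𝔡) + T(c) - S(c)}` … The first double sum is a bilinear form
of type (23.7) for which, after separating the variables `m, n` in `g(cmn)`, Proposition 23.1 gives
`T(c, 𝔡) ≪ N^{23/24+ε}`. Similarly … `T(c) ≪ N^{1-1/12r²+ε}`. The inner sum over primes in `S(c)` may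
be estimated using Theorem 2^ψ … `S(c) ≪ Σ_{q ≤ N^{1/r²}} c d(|k|+1) q N^{76/77}` …"

## What is here (everything PROVED; no named facts)

The objects: `roughInd P n` (the indicator "`(n, Π) = 1`": all prime factors `≥ P`), `fiBeta₀ p C P n`
(the coefficients (17.15) = (4.13) without the divisor cut, waived before §10; the cut version is the
tree's `fiBeta`), `spinCharSum g C P d χ k X` (the sum (25.1) for a general weight sequence `g`, i.e.
`Σ_{n ≤ X} ρ_P(n) g(n) μ(n) γ(n, C) λ(n)` with `λ` the quadratic eigenvalue (23.1) of the Hecke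
character (17.17) [tree: `quadEigenvalue`]), `weightVariation g X` (total variation of the weight),
`SpinCharSum.innerSum` (`S_c`), `SpinCharSum.coefC` (`κ_c(t) = [(c,t)=1] ρ(t) μ(t)`), `smoothInd`.

The estimates of §25, each in the raw form used by the assembly of Proposition 17.2
(`FriedlanderIwaniecSpinCharSumsProp172`):
* `spinCharSum_eq_sum_innerSum` — the `c`-expansion `S = Σ_{c ≤ C} μ(c) ρ(c) μ(c) S_c`;
* `bilinBoundedBy_quadEigenvalue` — Proposition 23.1 in the tree's `c^{1+ε}` form
  [tree: `norm_bilinear_quadEigenvalue_le`, from Proposition 21.4] as a `BilinBoundedBy` statement;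
* `norm_midBlock_le` — one dyadic block of the middle range (25.3)–(25.4) (restricted form `ℒ*`:
  coprimality removed by `BilinBoundedBy.coprime`, weight by `BilinBoundedBy.bvWeight`, the pairs
  with a large common divisor counted by `sum_sum_indicator_gcd_gt_le`);
* `norm_sigma1_le` — `T(c, 𝔡)`; `norm_sigma2_block_le` — a dyadic block of `T(c)`;
  `norm_sum_prime_log_mul_le`, `norm_primeSum_le`, `norm_sigma3_le` — `S(c)` from Theorem 2^ψ
  [tree: `FriedlanderIwaniec1998_theorem2psiWith_holds`] by Abel summation, the prime powers being
  removed with Chebyshev's `ψ(x) - θ(x) ≤ 2√x log x` [Mathlib: `Chebyshev.psi_sub_theta_le`];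
* `norm_innerSum_small_le` — the three pieces added up through Proposition 24.2
  [tree: `sum_sqfLE_eq_sepTriple_add`].

Two deviations from the printed argument, both harmless for Proposition 17.2 (which claims only SOME
`δ > 0`): (i) Proposition 23.1 is used in the `c^{1+ε}` form proved in the tree (the printed `τ(c)`
form is the unproved named fact `FriedlanderIwaniec1998_prop231`; its printed proof loses a factor
`∏_{p∣c}(1+O(p^{-11/12}))·(1 + log c)²`), so the exponents of the assembly are smaller than the
printed ones; (ii) the smooth weight `g(cmn)` is separated by Abel summation over its total variation
(`BilinBoundedBy.bvWeight`) rather than by the Mellin transform, which is why the estimates hold for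
any weight sequence of bounded variation, uniformly in the length `θN` of its support.

## References

* J. Friedlander, H. Iwaniec, Ann. of Math. (2) 148 (1998), 945–1040, §17 (17.14)–(17.18),
  Proposition 17.2; §23 Proposition 23.1; §24 Proposition 24.2; §25; §26 Theorem 2^ψ.
  [FriedlanderIwaniecAnnals1998]

## Tree / Mathlib

Tree: `quadEigenvalue`, `vonMangoldtEigenSum`, `FriedlanderIwaniec1998_theorem2psiWith`
(`FriedlanderIwaniecSpin`), `norm_bilinear_quadEigenvalue_le`, `norm_quadEigenvalue_le`
(`…SpinTheorem2Psi`), `BilinBoundedBy` + `.restrict/.twist/.cutoff/.bvWeight/.coprime/.const_mul`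
(`…ThresholdSeparation`, `…KubotaBilinear`, `…CutoffSeparation`), `norm_sum_Ioc_mul_le_of_partial`,
`variation_comp_mul_le` (`…CutoffSeparation`), `sqfLE`, `smoothSqf`, `primesIcc`, `roughCount`,
`IsPlusAdm`, `IsMinusAdm`, `squarefree_of_adm`, `disjoint_of_adm`, `coprime_of_primeFactors_disjoint`,
`sum_sqfLE_eq_sepTriple_add` (`…SeparationIdentity`), `SieveSequence.fiGamma` (`AsymptoticSieveForPrimes`),
`Vaughan.sum_Ioc_mul_two_pow_eq_sum` (`VaughanMeanValueDecomposition`). Mathlib: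
`ArithmeticFunction.isMultiplicative_moebius`, `Nat.squarefree_mul_iff`, `Nat.Ioc_filter_dvd_card_eq_div`,
`Chebyshev.psi_sub_theta_eq_sum_not_prime`, `Chebyshev.psi_sub_theta_le`.
-/

noncomputable section

open Finset Real
open scoped NumberTheorySymbols ArithmeticFunction.Moebius ArithmeticFunction.vonMangoldt
  ArithmeticFunction.Omega ArithmeticFunction.omega

namespace Literature.NumberTheory.Sieve.FriedlanderIwaniecPrimes

open Literature.NumberTheory.QuadraticFields.GaussianPrimary

/-! ### The coefficients (17.15) without the divisor cut, and the sum `S^k_χ(β')` -/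

/-- The indicator of the `P`-rough numbers: `1` if every prime factor of `n` is `≥ P` ("`(n, Π) = 1`",
`Π` the product of the primes below `P`, (4.21)/(17.14)), else `0`.
[cite: FriedlanderIwaniecAnnals1998, (17.14)] -/
def roughInd (P : ℝ) (n : ℕ) : ℂ := if ∀ q ∈ n.primeFactors, P ≤ (q : ℝ) then 1 else 0

/-- `‖roughInd P n‖ ≤ 1`. [cite: FriedlanderIwaniecAnnals1998, (17.14)] -/
theorem norm_roughInd_le (P : ℝ) (n : ℕ) : ‖roughInd P n‖ ≤ 1 := by
  unfold roughInd; split_ifs <;> simp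

/-- Multiplicativity of the rough indicator: `ρ(ab) = ρ(a) ρ(b)` for `a, b ≠ 0`.
[cite: FriedlanderIwaniecAnnals1998, (17.14)] -/
theorem roughInd_mul (P : ℝ) {a b : ℕ} (ha : a ≠ 0) (hb : b ≠ 0) :
    roughInd P (a * b) = roughInd P a * roughInd P b := by
  unfold roughInd
  rw [Nat.primeFactors_mul ha hb]
  by_cases h1 : ∀ q ∈ a.primeFactors, P ≤ (q : ℝ)
  · by_cases h2 : ∀ q ∈ b.primeFactors, P ≤ (q : ℝ)
    · rw [if_pos h1, if_pos h2, if_pos (fun q hq => by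
        rcases mem_union.mp hq with h | h
        exacts [h1 q h, h2 q h])]; ring
    · rw [if_pos h1, if_neg h2, if_neg (fun h => h2 fun q hq => h q (mem_union_right _ hq))]; ring
  · rw [if_neg h1, if_neg (fun h => h1 fun q hq => h q (mem_union_left _ hq))]; ring

/-- For a prime `p`: `ρ(p) = [P ≤ p]`. [cite: FriedlanderIwaniecAnnals1998, (17.14)] -/
theorem roughInd_prime (P : ℝ) {p : ℕ} (hp : p.Prime) :
    roughInd P p = if P ≤ (p : ℝ) then 1 else 0 := by
  unfold roughInd
  rw [hp.primeFactors]
  simp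

/-- FI (17.15)/(4.13) WITHOUT the divisor cut (5.9) (waived before §10): the coefficients
`β(n) = p(n) μ(n) Σ_{c ∣ n, c ≤ C} μ(c)`, set to `0` unless every prime factor of `n` is `≥ P`
("`(z, Π) = 1`" in (17.14)); `Σ_{c ∣ n, c ≤ C} μ(c)` is the tree's `SieveSequence.fiGamma C n` and
the version with the cut is the tree's `fiBeta p C P τ`. [cite: FriedlanderIwaniecAnnals1998, (17.15)] -/
def fiBeta₀ (p : ℝ → ℝ) (C P : ℝ) (n : ℕ) : ℝ :=
  if (∀ q ∈ n.primeFactors, P ≤ (q : ℝ)) then p n * (μ n : ℝ) * (SieveSequence.fiGamma C n : ℝ)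
  else 0

/-- `fiBeta₀` unfolded. [cite: FriedlanderIwaniecAnnals1998, (17.15)] -/
theorem fiBeta₀_def (p : ℝ → ℝ) (C P : ℝ) (n : ℕ) :
    fiBeta₀ p C P n = if (∀ q ∈ n.primeFactors, P ≤ (q : ℝ)) then
      p n * (μ n : ℝ) * (SieveSequence.fiGamma C n : ℝ) else 0 := rfl

/-- `(β₀(n) : ℂ) = ρ_P(n) · p(n) μ(n) γ(n, C)`. [cite: FriedlanderIwaniecAnnals1998, (17.15)] -/
theorem fiBeta₀_eq_roughInd_mul (p : ℝ → ℝ) (C P : ℝ) (n : ℕ) :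
    ((fiBeta₀ p C P n : ℝ) : ℂ) =
      roughInd P n * ((p n : ℂ) * (μ n : ℂ) * (SieveSequence.fiGamma C n : ℂ)) := by
  unfold fiBeta₀ roughInd
  split_ifs <;> push_cast <;> ring

/-- The general sum of §25: `S(g; C, P; ψ; X) = Σ_{n ≤ X} ρ_P(n) g(n) μ(n) γ(n, C) λ(n)` for a weight
sequence `g` (in (25.1) `g` is the smooth partition function `p(n)` of (4.13), supported on
`N' < n ≤ (1+θ)N'`, and `λ` is the quadratic eigenvalue (23.1) of the Hecke character (17.17)).
[cite: FriedlanderIwaniecAnnals1998, (25.1)-(25.2)] -/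
def spinCharSum (g : ℕ → ℂ) (C P : ℝ) (d : ℕ) (χ : MulChar (GaussQuot (4 * d)) ℂ) (k : ℤ)
    (X : ℕ) : ℂ :=
  ∑ n ∈ Icc 1 X, roughInd P n * (g n * (μ n : ℂ) * (SieveSequence.fiGamma C n : ℂ)) *
    quadEigenvalue d χ k n

/-- The total variation of a weight sequence on `[1, X]` (with the convention that the weight is
compared with its next value, so that a weight vanishing beyond `X` pays `|g(X)|` at the end).
[cite: FriedlanderIwaniecAnnals1998, §25] -/
def weightVariation (g : ℕ → ℂ) (X : ℕ) : ℝ := ∑ y ∈ Icc 1 X, ‖g y - g (y + 1)‖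

/-- `0 ≤ V(g)`. [cite: FriedlanderIwaniecAnnals1998, §25] -/
theorem weightVariation_nonneg (g : ℕ → ℂ) (X : ℕ) : 0 ≤ weightVariation g X :=
  sum_nonneg fun _ _ => norm_nonneg _

namespace SpinCharSum

/-! ### Arithmetic of the coefficients -/

/-- `μ(ab) = [(a,b)=1] μ(a) μ(b)`. [folklore] -/
private theorem moebius_mul_eq (a b : ℕ) :
    (μ (a * b) : ℂ) = (if Nat.Coprime a b then 1 else 0) * (μ a : ℂ) * (μ b : ℂ) := by
  by_cases h : Nat.Coprime a b
  · rw [if_pos h, ArithmeticFunction.isMultiplicative_moebius.map_mul_of_coprime h]; push_cast; ring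
  · rw [if_neg h]
    rcases Nat.eq_zero_or_pos a with rfl | ha
    · simp
    rcases Nat.eq_zero_or_pos b with rfl | hb
    · simp
    have : ¬ Squarefree (a * b) := fun hs => h (Nat.squarefree_mul_iff.mp hs).1
    rw [ArithmeticFunction.moebius_eq_zero_of_not_squarefree this]; simp

/-- The inner coefficient of §25 after `n = cℓ`:
`ρ(cℓ) μ(cℓ) = (ρ(c) μ(c)) · ([(c,ℓ)=1] ρ(ℓ) μ(ℓ))` (`c, ℓ ≥ 1`). [cite: FriedlanderIwaniecAnnals1998, §25 (before (25.3))] -/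
theorem roughInd_mul_moebius_mul {P : ℝ} {c ℓ : ℕ} (hc : 1 ≤ c) (hℓ : 1 ≤ ℓ) :
    roughInd P (c * ℓ) * (μ (c * ℓ) : ℂ) =
      (roughInd P c * (μ c : ℂ)) * ((if Nat.Coprime c ℓ then 1 else 0) * roughInd P ℓ * (μ ℓ : ℂ)) := by
  rw [roughInd_mul P (by omega) (by omega), moebius_mul_eq]; ring

/-! ### The `c`-expansion: `S = Σ_{c ≤ C} μ(c) ρ(c) μ(c) · S_c` -/

/-- The inner sum `S_c = Σ_{ℓ ≤ X/c} [(c,ℓ)=1] ρ(ℓ) μ(ℓ) g(cℓ) λ(cℓ)` of the `c`-expansion.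
[cite: FriedlanderIwaniecAnnals1998, §25 (before (25.3))] -/
def innerSum (g : ℕ → ℂ) (P : ℝ) (d : ℕ) (χ : MulChar (GaussQuot (4 * d)) ℂ) (k : ℤ)
    (X c : ℕ) : ℂ :=
  ∑ ℓ ∈ Icc 1 (X / c), (if Nat.Coprime c ℓ then 1 else 0) * roughInd P ℓ * (μ ℓ : ℂ) *
    g (c * ℓ) * quadEigenvalue d χ k (c * ℓ)

/-- **The `c`-expansion** ("changing the order of summation", §25 before (25.3)):
`S = Σ_{1 ≤ c ≤ C} μ(c) · (ρ(c) μ(c)) · S_c`. [cite: FriedlanderIwaniecAnnals1998, §25 (before (25.3))] -/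
theorem spinCharSum_eq_sum_innerSum (g : ℕ → ℂ) (C P : ℝ) (d : ℕ)
    (χ : MulChar (GaussQuot (4 * d)) ℂ) (k : ℤ) (X : ℕ) :
    spinCharSum g C P d χ k X =
      ∑ c ∈ Icc 1 ⌊C⌋₊, (μ c : ℂ) * (roughInd P c * (μ c : ℂ)) * innerSum g P d χ k X c := by
  classical
  unfold spinCharSum innerSum
  -- expand `γ(n, C)` and write the double sum over the pairs `(c, n)` with `c ∣ n`
  have hγ : ∀ n ∈ Icc 1 X, (SieveSequence.fiGamma C n : ℂ) =
      ∑ c ∈ (Icc 1 ⌊C⌋₊).filter (· ∣ n), (μ c : ℂ) := by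
    intro n hn
    rw [mem_Icc] at hn
    rw [SieveSequence.fiGamma_def]
    push_cast
    refine sum_congr ?_ fun _ _ => rfl
    ext c
    simp only [mem_filter, Nat.mem_divisors, mem_Icc]
    constructor
    · rintro ⟨⟨hd, -⟩, hC⟩
      exact ⟨⟨Nat.pos_of_dvd_of_pos hd (by omega), Nat.le_floor hC⟩, hd⟩
    · rintro ⟨⟨h1, h2⟩, hd⟩
      refine ⟨⟨hd, by omega⟩, ?_⟩
      have hC0 : (0 : ℝ) ≤ C := by
        by_contra hneg
        push Not at hneg
        have : ⌊C⌋₊ = 0 := Nat.floor_of_nonpos hneg.le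
        omega
      exact (Nat.floor_le hC0).trans' (by exact_mod_cast h2)
  calc ∑ n ∈ Icc 1 X, roughInd P n * (g n * (μ n : ℂ) * (SieveSequence.fiGamma C n : ℂ)) *
        quadEigenvalue d χ k n
      = ∑ n ∈ Icc 1 X, ∑ c ∈ (Icc 1 ⌊C⌋₊).filter (· ∣ n),
          (μ c : ℂ) * (roughInd P n * (g n * (μ n : ℂ)) * quadEigenvalue d χ k n) := by
        refine sum_congr rfl fun n hn => ?_
        rw [hγ n hn]
        simp only [mul_sum, sum_mul]
        exact sum_congr rfl fun c _ => by ring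
    _ = ∑ c ∈ Icc 1 ⌊C⌋₊, ∑ n ∈ (Icc 1 X).filter (c ∣ ·),
          (μ c : ℂ) * (roughInd P n * (g n * (μ n : ℂ)) * quadEigenvalue d χ k n) := by
        rw [sum_comm' (t' := Icc 1 ⌊C⌋₊) (s' := fun c => (Icc 1 X).filter (c ∣ ·))]
        intro n c
        simp only [mem_filter]
        tauto
    _ = _ := by
        refine sum_congr rfl fun c hc => ?_
        rw [mem_Icc] at hc
        rw [mul_sum]
        -- reindex `n = c ℓ`
        have himage : (Icc 1 X).filter (c ∣ ·) = (Icc 1 (X / c)).image (c * ·) := by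
          ext n
          simp only [mem_filter, mem_Icc, mem_image]
          constructor
          · rintro ⟨⟨h1, h2⟩, ⟨ℓ, rfl⟩⟩
            refine ⟨ℓ, ⟨?_, ?_⟩, rfl⟩
            · rcases Nat.eq_zero_or_pos ℓ with rfl | hℓ
              · simp at h1
              · exact hℓ
            · exact (Nat.le_div_iff_mul_le (by omega)).mpr (by rw [mul_comm]; exact h2)
          · rintro ⟨ℓ, ⟨h1, h2⟩, rfl⟩
            refine ⟨⟨Nat.mul_pos (by omega) h1, ?_⟩, dvd_mul_right c ℓ⟩
            have := (Nat.le_div_iff_mul_le (by omega)).mp h2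
            rw [mul_comm]; exact this
        rw [himage, sum_image (fun a _ b _ hab => Nat.eq_of_mul_eq_mul_left (by omega) hab)]
        refine sum_congr rfl fun ℓ hℓ => ?_
        rw [mem_Icc] at hℓ
        have key := roughInd_mul_moebius_mul (P := P) hc.1 hℓ.1
        calc (μ c : ℂ) * (roughInd P (c * ℓ) * (g (c * ℓ) * (μ (c * ℓ) : ℂ)) * quadEigenvalue d χ k (c * ℓ))
            = (μ c : ℂ) * (roughInd P (c * ℓ) * (μ (c * ℓ) : ℂ)) * g (c * ℓ) * quadEigenvalue d χ k (c * ℓ) := by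
              ring
          _ = _ := by rw [key]; ring

/-! ### The basic kernel bound: Proposition 23.1 in the `c^{1+ε}` form, as a `BilinBoundedBy` statement -/

/-- **The type-II kernel bound** [tree: `norm_bilinear_quadEigenvalue_le`, Proposition 21.4 ⇒ 23.1
with `c^{1+ε}`] in `BilinBoundedBy` form on sub-boxes: for `W ⊆ [1, M₀]`, `Z ⊆ [1, N₀]`, every bilinear
form `Σ_{m∈W} Σ_{n∈Z} a(m) b(n) λ(cmn)` with `|a|, |b| ≤ 1` is
`≤ C c^{1+ε} (M₀ + N₀)^{1/12} (M₀ N₀)^{11/12+ε}`. [cite: FriedlanderIwaniecAnnals1998, Proposition 23.1] -/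
theorem bilinBoundedBy_quadEigenvalue {ε : ℝ} (hε : 0 < ε) :
    ∃ C : ℝ, 0 < C ∧ ∀ d : ℕ, 1 ≤ d → ∀ χ : MulChar (GaussQuot (4 * d)) ℂ, ∀ k : ℤ,
      ∀ c : ℕ, 1 ≤ c → ∀ M₀ N₀ : ℕ, 1 ≤ M₀ → 1 ≤ N₀ → ∀ W Z : Finset ℕ, W ⊆ Icc 1 M₀ → Z ⊆ Icc 1 N₀ →
        BilinBoundedBy (fun m n => quadEigenvalue d χ k (c * m * n)) W Z
          (C * (c : ℝ) ^ (1 + ε) * ((M₀ : ℝ) + N₀) ^ (1 / 12 : ℝ) * ((M₀ : ℝ) * N₀) ^ (11 / 12 + ε)) := by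
  obtain ⟨C, hC, h⟩ := norm_bilinear_quadEigenvalue_le hε
  refine ⟨C, hC, fun d hd χ k c hc M₀ N₀ hM hN W Z hW hZ => ?_⟩
  have hfull : BilinBoundedBy (fun m n => quadEigenvalue d χ k (c * m * n)) (Icc 1 M₀) (Icc 1 N₀)
      (C * (c : ℝ) ^ (1 + ε) * ((M₀ : ℝ) + N₀) ^ (1 / 12 : ℝ) * ((M₀ : ℝ) * N₀) ^ (11 / 12 + ε)) :=
    fun a b ha hb => h d hd χ k c hc M₀ N₀ hM hN a b ha hb
  exact hfull.restrict hW hZ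

/-! ### Pairs with a large common divisor -/

/-- `Σ_{B₀ < b ≤ L} 1/(b(b-1)) ≤ 1/B₀` (telescoping), for `B₀ ≥ 1`. [folklore] -/
private theorem sum_Ioc_inv_mul_pred_le {B₀ : ℕ} (hB : 1 ≤ B₀) (L : ℕ) :
    ∑ b ∈ Ioc B₀ L, (1 : ℝ) / ((b : ℝ) * ((b : ℝ) - 1)) ≤ 1 / B₀ := by
  rcases le_or_gt B₀ L with hL | hL
  · have htel : ∀ L, B₀ ≤ L → ∑ b ∈ Ioc B₀ L, (1 : ℝ) / ((b : ℝ) * ((b : ℝ) - 1)) = 1 / B₀ - 1 / L := by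
      intro L hL
      induction L, hL using Nat.le_induction with
      | base => simp
      | succ L hL ih =>
        rw [sum_Ioc_succ_top (by omega), ih]
        have hL0 : (0 : ℝ) < L := by exact_mod_cast (by omega : 0 < L)
        have hB0 : (0 : ℝ) < B₀ := by exact_mod_cast (by omega : 0 < B₀)
        push_cast
        rw [show ((L : ℝ) + 1 - 1) = L by ring]
        field_simp
        ring
    rw [htel L hL]
    have : (0 : ℝ) ≤ 1 / L := by positivity
    linarith
  · rw [Finset.Ioc_eq_empty (by omega), sum_empty]; positivity

/-- **Few pairs have a large common divisor**: `#{(m, n) ∈ [1,M]×[1,N] : (m,n) > B₀} ≤ MN/B₀`, in the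
form `Σ_{m ≤ M} Σ_{n ≤ N} [B₀ < (m,n)] ≤ MN/B₀` (`B₀ ≥ 1`).
[cite: FriedlanderIwaniecAnnals1998, Proposition 23.1 (proof, removal of `(m,n)=1`)] -/
theorem sum_sum_indicator_gcd_gt_le (M N : ℕ) {B₀ : ℕ} (hB : 1 ≤ B₀) :
    ∑ m ∈ Icc 1 M, ∑ n ∈ Icc 1 N, (if B₀ < Nat.gcd m n then (1 : ℝ) else 0) ≤ (M : ℝ) * N / B₀ := by
  -- `[B₀ < gcd] ≤ Σ_{B₀ < b ≤ M} [b ∣ m] [b ∣ n]`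
  have hpt : ∀ m ∈ Icc 1 M, ∀ n ∈ Icc 1 N, (if B₀ < Nat.gcd m n then (1 : ℝ) else 0) ≤
      ∑ b ∈ Ioc B₀ M, (if b ∣ m then (1 : ℝ) else 0) * (if b ∣ n then (1 : ℝ) else 0) := by
    intro m hm n hn
    rw [mem_Icc] at hm
    split_ifs with h
    · have hgm : Nat.gcd m n ∈ Ioc B₀ M :=
        mem_Ioc.mpr ⟨h, (Nat.le_of_dvd (by omega) (Nat.gcd_dvd_left m n)).trans hm.2⟩
      refine le_trans ?_ (single_le_sum (f := fun b => (if b ∣ m then (1 : ℝ) else 0) *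
        (if b ∣ n then (1 : ℝ) else 0)) (fun b _ => by positivity) hgm)
      rw [if_pos (Nat.gcd_dvd_left m n), if_pos (Nat.gcd_dvd_right m n), mul_one]
    · exact sum_nonneg fun b _ => by positivity
  refine (sum_le_sum fun m hm => sum_le_sum fun n hn => hpt m hm n hn).trans ?_
  rw [sum_congr rfl fun m _ => Finset.sum_comm, Finset.sum_comm]
  simp_rw [← mul_sum, ← sum_mul]
  -- `Σ_{m ≤ M} [b ∣ m] = M / b`
  have hcount : ∀ b K : ℕ, ∑ m ∈ Icc 1 K, (if b ∣ m then (1 : ℝ) else 0) = ((K / b : ℕ) : ℝ) := by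
    intro b K
    rw [← sum_filter, sum_const, nsmul_eq_mul, mul_one]
    have : Icc 1 K = Ioc 0 K := by ext m; simp only [mem_Icc, mem_Ioc]; omega
    rw [this, Nat.Ioc_filter_dvd_card_eq_div]
  simp_rw [hcount]
  calc ∑ b ∈ Ioc B₀ M, ((M / b : ℕ) : ℝ) * ((N / b : ℕ) : ℝ)
      ≤ ∑ b ∈ Ioc B₀ M, (M : ℝ) * N * (1 / ((b : ℝ) * ((b : ℝ) - 1))) := by
        refine sum_le_sum fun b hb => ?_
        rw [mem_Ioc] at hb
        have hb1 : (1 : ℝ) < b := by exact_mod_cast (by omega : 1 < b)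
        have h1 : ((M / b : ℕ) : ℝ) ≤ (M : ℝ) / b := Nat.cast_div_le
        have h2 : ((N / b : ℕ) : ℝ) ≤ (N : ℝ) / b := Nat.cast_div_le
        calc ((M / b : ℕ) : ℝ) * ((N / b : ℕ) : ℝ) ≤ ((M : ℝ) / b) * ((N : ℝ) / b) :=
              mul_le_mul h1 h2 (Nat.cast_nonneg _) (by positivity)
          _ = (M : ℝ) * N * (1 / ((b : ℝ) * b)) := by field_simp
          _ ≤ (M : ℝ) * N * (1 / ((b : ℝ) * ((b : ℝ) - 1))) := by
              refine mul_le_mul_of_nonneg_left ?_ (by positivity)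
              exact one_div_le_one_div_of_le (by nlinarith) (by nlinarith)
    _ = (M : ℝ) * N * ∑ b ∈ Ioc B₀ M, (1 / ((b : ℝ) * ((b : ℝ) - 1))) := by rw [mul_sum]
    _ ≤ (M : ℝ) * N * (1 / B₀) := mul_le_mul_of_nonneg_left (sum_Ioc_inv_mul_pred_le hB M) (by positivity)
    _ = (M : ℝ) * N / B₀ := by ring

/-! ### The middle range `C₀ < c ≤ C`: one dyadic block as a bilinear form in `(c, ℓ)` -/

/-- **One dyadic block of the middle range** ((25.3)–(25.4): "the remaining partial sum of
`S^k_χ(β')` over `m = cℓ` with `N^η < c ≤ N^{1-η}` is a bilinear form of type `ℒ*(A, B)` … for which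
Proposition 23.1 gives the bound"): for `1 ≤ A ≤ X`, coefficients `|a(c)| ≤ 1`, a weight `g`
vanishing beyond `X ≥ 1` with `|g| ≤ 1`, a uniform divisor bound `τ(n) ≤ T` (`n ≤ X`), any
`B₀ ≥ 1` and the kernel constant `C` of `bilinBoundedBy_quadEigenvalue` (at `c = 1`),
`‖Σ_{A < c ≤ 2A} a(c) S_c‖ ≤ B₀ · V(g) log(6X) · C (2A + X/A)^{1/12} (2A · X/A)^{11/12+ε} + T² (2A)(X/A)/B₀`
(restricted form via `BilinBoundedBy.coprime`, weight via `BilinBoundedBy.bvWeight`).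
[cite: FriedlanderIwaniecAnnals1998, (25.3)-(25.4)] -/
theorem norm_midBlock_le {ε : ℝ} {C : ℝ}
    (hC : ∀ d : ℕ, 1 ≤ d → ∀ χ : MulChar (GaussQuot (4 * d)) ℂ, ∀ k : ℤ,
      ∀ c : ℕ, 1 ≤ c → ∀ M₀ N₀ : ℕ, 1 ≤ M₀ → 1 ≤ N₀ → ∀ W Z : Finset ℕ, W ⊆ Icc 1 M₀ → Z ⊆ Icc 1 N₀ →
        BilinBoundedBy (fun m n => quadEigenvalue d χ k (c * m * n)) W Z
          (C * (c : ℝ) ^ (1 + ε) * ((M₀ : ℝ) + N₀) ^ (1 / 12 : ℝ) * ((M₀ : ℝ) * N₀) ^ (11 / 12 + ε)))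
    {d : ℕ} (hd : 1 ≤ d) (χ : MulChar (GaussQuot (4 * d)) ℂ) (k : ℤ) {X A : ℕ} (hA : 1 ≤ A)
    (hAX : A ≤ X) (g : ℕ → ℂ) (hg0 : ∀ n, X < n → g n = 0) (hg1 : ∀ n, ‖g n‖ ≤ 1) (P : ℝ)
    (a : ℕ → ℂ) (ha : ∀ c, ‖a c‖ ≤ 1) {T : ℝ} (hT : ∀ n, 1 ≤ n → n ≤ X → ((Nat.divisors n).card : ℝ) ≤ T)
    {B₀ : ℕ} (hB : 1 ≤ B₀) :
    ‖∑ c ∈ Ioc A (2 * A), a c * innerSum g P d χ k X c‖ ≤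
      B₀ * (weightVariation g X * Real.log (6 * X) *
        (C * (((2 * A : ℕ) : ℝ) + ((X / A : ℕ) : ℝ)) ^ (1 / 12 : ℝ) *
          (((2 * A : ℕ) : ℝ) * ((X / A : ℕ) : ℝ)) ^ (11 / 12 + ε))) +
      T ^ 2 * (((2 * A : ℕ) : ℝ) * ((X / A : ℕ) : ℝ) / B₀) := by
  have hX : 1 ≤ X := hA.trans hAX
  have hN₀ : 1 ≤ X / A := (Nat.div_pos hAX hA)
  set W : Finset ℕ := Ioc A (2 * A) with hW
  set Z : Finset ℕ := Icc 1 (X / A) with hZ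
  have hWsub : W ⊆ Icc 1 (2 * A) := fun c hc => by
    rw [hW, mem_Ioc] at hc; rw [mem_Icc]; omega
  have hW1 : ∀ c ∈ W, 1 ≤ c := fun c hc => by rw [hW, mem_Ioc] at hc; omega
  have hZ1 : ∀ ℓ ∈ Z, 1 ≤ ℓ := fun ℓ hℓ => by rw [hZ, mem_Icc] at hℓ; exact hℓ.1
  -- Step 1: extend the inner ranges to `Z`
  have hinner : ∀ c ∈ W, innerSum g P d χ k X c =
      ∑ ℓ ∈ Z, (if Nat.Coprime c ℓ then 1 else 0) * roughInd P ℓ * (μ ℓ : ℂ) *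
        g (c * ℓ) * quadEigenvalue d χ k (c * ℓ) := by
    intro c hc
    rw [hW, mem_Ioc] at hc
    rw [innerSum]
    refine sum_subset (fun ℓ hℓ => ?_) (fun ℓ hℓ hℓ' => ?_)
    · rw [mem_Icc] at hℓ ⊢
      exact ⟨hℓ.1, hℓ.2.trans (Nat.div_le_div_left hc.1.le hA)⟩
    · rw [hZ, mem_Icc] at hℓ
      rw [mem_Icc, not_and, not_le] at hℓ'
      have hlt := hℓ' hℓ.1
      have : X < c * ℓ := by
        rw [Nat.div_lt_iff_lt_mul (by omega)] at hlt
        rw [mul_comm]; exact hlt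
      rw [hg0 _ this]; ring
  -- Step 2: the kernel chain
  have hK₀ : BilinBoundedBy (fun c ℓ => quadEigenvalue d χ k (1 * c * ℓ)) W Z
      (C * (1 : ℝ) ^ (1 + ε) * (((2 * A : ℕ) : ℝ) + ((X / A : ℕ) : ℝ)) ^ (1 / 12 : ℝ) *
        (((2 * A : ℕ) : ℝ) * ((X / A : ℕ) : ℝ)) ^ (11 / 12 + ε)) := by
    have := hC d hd χ k 1 le_rfl (2 * A) (X / A) (by omega) hN₀ W Z hWsub (subset_refl _)
    simpa using this
  set B : ℝ := C * (((2 * A : ℕ) : ℝ) + ((X / A : ℕ) : ℝ)) ^ (1 / 12 : ℝ) *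
      (((2 * A : ℕ) : ℝ) * ((X / A : ℕ) : ℝ)) ^ (11 / 12 + ε) with hBdef
  have hK₀' : BilinBoundedBy (fun c ℓ => quadEigenvalue d χ k (c * ℓ)) W Z B := by
    refine (hK₀.congr fun c _ ℓ _ => by rw [one_mul]).mono (le_of_eq ?_)
    rw [hBdef, Real.one_rpow, mul_one]
  have hK₁ : BilinBoundedBy (fun c ℓ => g (c * ℓ) * quadEigenvalue d χ k (c * ℓ)) W Z
      (weightVariation g X * Real.log (6 * X) * B) := by
    have := hK₀'.bvWeight (u := id) (v := id) hW1 hZ1 g hX hg0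
    exact this
  have hK₂ := hK₁.coprime (u := id) (id : ℕ → ℕ) hW1 B₀
  -- Step 3: apply to the coefficients
  have hval := hK₂ a (fun ℓ => roughInd P ℓ * (μ ℓ : ℂ)) ha (fun ℓ => by
    rw [norm_mul]
    refine mul_le_one₀ (norm_roughInd_le P ℓ) (norm_nonneg _) ?_
    rw [Complex.norm_intCast]; exact_mod_cast ArithmeticFunction.abs_moebius_le_one)
  have hrw : ∑ c ∈ W, a c * innerSum g P d χ k X c =
      ∑ c ∈ W, ∑ ℓ ∈ Z, a c * (roughInd P ℓ * (μ ℓ : ℂ)) *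
        ((if Nat.Coprime (id c) (id ℓ) then (1 : ℂ) else 0) * (g (id c * id ℓ) * quadEigenvalue d χ k (c * ℓ))) := by
    refine sum_congr rfl fun c hc => ?_
    rw [hinner c hc, mul_sum]
    exact sum_congr rfl fun ℓ _ => by simp only [id]; ring
  rw [hrw]
  refine hval.trans (add_le_add le_rfl ?_)
  -- Step 4: the pairs with large gcd
  have hterm : ∀ c ∈ W, ∀ ℓ ∈ Z,
      (if B₀ < Nat.gcd (id c) (id ℓ) then ((Nat.gcd (id c) (id ℓ)).divisors.card : ℝ) *
          ‖g (id c * id ℓ) * quadEigenvalue d χ k (c * ℓ)‖ else 0) ≤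
        T ^ 2 * (if B₀ < Nat.gcd c ℓ then (1 : ℝ) else 0) := by
    intro c hc ℓ hℓ
    simp only [id]
    have hc1 := hW1 c hc
    have hℓ1 := hZ1 ℓ hℓ
    split_ifs with hgcd
    · rw [mul_one]
      by_cases hcl : c * ℓ ≤ X
      · have hτg : ((Nat.gcd c ℓ).divisors.card : ℝ) ≤ T :=
          hT _ (Nat.gcd_pos_of_pos_left ℓ hc1) ((Nat.gcd_le_left ℓ hc1).trans
            ((Nat.le_mul_of_pos_right c hℓ1).trans hcl))
        have hK : ‖g (c * ℓ) * quadEigenvalue d χ k (c * ℓ)‖ ≤ T := by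
          rw [norm_mul]
          calc ‖g (c * ℓ)‖ * ‖quadEigenvalue d χ k (c * ℓ)‖ ≤ 1 * ((c * ℓ).divisors.card : ℝ) :=
                mul_le_mul (hg1 _) (norm_quadEigenvalue_le d hd χ k _) (norm_nonneg _) zero_le_one
            _ ≤ T := by rw [one_mul]; exact hT _ (Nat.mul_pos hc1 hℓ1) hcl
        have hT0 : 0 ≤ T := le_trans (by positivity) hτg
        calc ((Nat.gcd c ℓ).divisors.card : ℝ) * ‖g (c * ℓ) * quadEigenvalue d χ k (c * ℓ)‖
            ≤ T * T := mul_le_mul hτg hK (norm_nonneg _) hT0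
          _ = T ^ 2 := by ring
      · push Not at hcl
        rw [hg0 _ hcl, zero_mul, norm_zero, mul_zero]
        positivity
    · simp
  calc ∑ c ∈ W, ∑ ℓ ∈ Z, (if B₀ < Nat.gcd (id c) (id ℓ) then
          ((Nat.gcd (id c) (id ℓ)).divisors.card : ℝ) * ‖g (id c * id ℓ) * quadEigenvalue d χ k (c * ℓ)‖ else 0)
      ≤ ∑ c ∈ W, ∑ ℓ ∈ Z, T ^ 2 * (if B₀ < Nat.gcd c ℓ then (1 : ℝ) else 0) :=
        sum_le_sum fun c hc => sum_le_sum fun ℓ hℓ => hterm c hc ℓ hℓ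
    _ = T ^ 2 * ∑ c ∈ W, ∑ ℓ ∈ Z, (if B₀ < Nat.gcd c ℓ then (1 : ℝ) else 0) := by
        rw [mul_sum]; simp_rw [mul_sum]
    _ ≤ T ^ 2 * ∑ c ∈ Icc 1 (2 * A), ∑ ℓ ∈ Z, (if B₀ < Nat.gcd c ℓ then (1 : ℝ) else 0) := by
        refine mul_le_mul_of_nonneg_left (sum_le_sum_of_subset_of_nonneg hWsub fun c _ _ =>
          sum_nonneg fun ℓ _ => by positivity) (sq_nonneg T)
    _ ≤ T ^ 2 * (((2 * A : ℕ) : ℝ) * ((X / A : ℕ) : ℝ) / B₀) :=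
        mul_le_mul_of_nonneg_left (sum_sum_indicator_gcd_gt_le _ _ hB) (sq_nonneg T)

/-! ### The small range `c ≤ C₀`: the coefficients of the separated sums -/

/-- The indicator of the `z`-smooth numbers (all prime factors `< z`). [cite: FriedlanderIwaniecAnnals1998, (24.9)] -/
def smoothInd (z n : ℕ) : ℂ := if ∀ p ∈ n.primeFactors, p < z then 1 else 0

/-- `‖smoothInd z n‖ ≤ 1`. [cite: FriedlanderIwaniecAnnals1998, (24.9)] -/
theorem norm_smoothInd_le (z n : ℕ) : ‖smoothInd z n‖ ≤ 1 := by
  unfold smoothInd; split_ifs <;> simp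

/-- `smoothInd z (ab) = smoothInd z a · smoothInd z b` for `a, b ≠ 0`. [cite: FriedlanderIwaniecAnnals1998, (24.9)] -/
theorem smoothInd_mul (z : ℕ) {a b : ℕ} (ha : a ≠ 0) (hb : b ≠ 0) :
    smoothInd z (a * b) = smoothInd z a * smoothInd z b := by
  unfold smoothInd
  rw [Nat.primeFactors_mul ha hb]
  by_cases h1 : ∀ p ∈ a.primeFactors, p < z
  · by_cases h2 : ∀ p ∈ b.primeFactors, p < z
    · rw [if_pos h1, if_pos h2, if_pos (fun q hq => by
        rcases mem_union.mp hq with h | h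
        exacts [h1 q h, h2 q h])]; ring
    · rw [if_pos h1, if_neg h2, if_neg (fun h => h2 fun q hq => h q (mem_union_right _ hq))]; ring
  · rw [if_neg h1, if_neg (fun h => h1 fun q hq => h q (mem_union_left _ hq))]; ring

/-- The coefficient `κ_c(t) = [(c,t)=1] ρ_P(t) μ(t)` of `f_c(t) = κ_c(t) g(ct) λ(ct)`.
[cite: FriedlanderIwaniecAnnals1998, §25] -/
def coefC (c : ℕ) (P : ℝ) (t : ℕ) : ℂ := (if Nat.Coprime c t then 1 else 0) * roughInd P t * (μ t : ℂ)

/-- `‖κ_c(t)‖ ≤ 1`. [cite: FriedlanderIwaniecAnnals1998, §25] -/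
theorem norm_coefC_le (c : ℕ) (P : ℝ) (t : ℕ) : ‖coefC c P t‖ ≤ 1 := by
  unfold coefC
  rw [norm_mul, norm_mul]
  refine mul_le_one₀ (mul_le_one₀ ?_ (norm_nonneg _) (norm_roughInd_le P t)) (norm_nonneg _) ?_
  · split_ifs <;> simp
  · rw [Complex.norm_intCast]; exact_mod_cast ArithmeticFunction.abs_moebius_le_one

/-- `κ_c(ab) = κ_c(a) κ_c(b)` for coprime `a, b ≥ 1`. [cite: FriedlanderIwaniecAnnals1998, §25] -/
theorem coefC_mul_of_coprime (c : ℕ) (P : ℝ) {a b : ℕ} (ha : a ≠ 0) (hb : b ≠ 0)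
    (hab : Nat.Coprime a b) : coefC c P (a * b) = coefC c P a * coefC c P b := by
  unfold coefC
  rw [roughInd_mul P ha hb, ArithmeticFunction.isMultiplicative_moebius.map_mul_of_coprime hab]
  push_cast
  have : (if Nat.Coprime c (a * b) then (1 : ℂ) else 0) =
      (if Nat.Coprime c a then 1 else 0) * (if Nat.Coprime c b then 1 else 0) := by
    simp only [Nat.coprime_mul_iff_right]
    by_cases h1 : Nat.Coprime c a
    · by_cases h2 : Nat.Coprime c b
      · rw [if_pos ⟨h1, h2⟩, if_pos h1, if_pos h2, mul_one]
      · rw [if_neg (fun h => h2 h.2), if_neg h2, mul_zero]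
    · rw [if_neg (fun h => h1 h.1), if_neg h1, zero_mul]
  rw [this]; ring

/-- `κ_c` vanishes off the squarefree numbers. [cite: FriedlanderIwaniecAnnals1998, §25] -/
theorem coefC_eq_zero_of_not_squarefree (c : ℕ) (P : ℝ) {t : ℕ} (ht : ¬ Squarefree t) :
    coefC c P t = 0 := by
  unfold coefC
  rw [ArithmeticFunction.moebius_eq_zero_of_not_squarefree ht]; simp

/-- The inner sum is the sum of `f_c` over the squarefree `ℓ ≤ X/c` (the left side of Proposition
24.2 with `x = X/c`). [cite: FriedlanderIwaniecAnnals1998, §25] -/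
theorem innerSum_eq_sum_sqfLE (g : ℕ → ℂ) (P : ℝ) (d : ℕ) (χ : MulChar (GaussQuot (4 * d)) ℂ)
    (k : ℤ) (X c : ℕ) :
    innerSum g P d χ k X c =
      ∑ ℓ ∈ sqfLE (X / c), coefC c P ℓ * g (c * ℓ) * quadEigenvalue d χ k (c * ℓ) := by
  rw [innerSum, sqfLE, sum_filter]
  refine sum_congr rfl fun ℓ _ => ?_
  by_cases hsq : Squarefree ℓ
  · rw [if_pos hsq, coefC]
  · rw [if_neg hsq, ArithmeticFunction.moebius_eq_zero_of_not_squarefree hsq]; simp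

/-! ### The small range: the piece `T(c, 𝔡)` -/

/-- **The bilinear form `T(c, 𝔡)`** (§25: "The first double sum is a bilinear form of type (23.7) for
which, after separating the variables `m, n` in `g(cmn)`, Proposition 23.1 gives
`T(c, 𝔡) ≪ N^{23/24+ε}`"): for `1 ≤ c ≤ X`, `x = X/c`, `𝔡 ≥ 1`, a weight `g` vanishing beyond `X`
with `|g| ≤ 1`, and the kernel constant `C` of `bilinBoundedBy_quadEigenvalue`, the `𝔡`-term of the
first sum of Proposition 24.2 applied to `f_c` has norm at most
`V(g) log(6X) · C (c𝔡)^{1+ε} (2√x)^{1/12} x^{11/12+ε}` (here `√x = Nat.sqrt x`).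
[cite: FriedlanderIwaniecAnnals1998, §25 (the bound for `T(c,𝔡)`)] -/
theorem norm_sigma1_le {ε : ℝ} {C : ℝ}
    (hC : ∀ d : ℕ, 1 ≤ d → ∀ χ : MulChar (GaussQuot (4 * d)) ℂ, ∀ k : ℤ,
      ∀ c : ℕ, 1 ≤ c → ∀ M₀ N₀ : ℕ, 1 ≤ M₀ → 1 ≤ N₀ → ∀ W Z : Finset ℕ, W ⊆ Icc 1 M₀ → Z ⊆ Icc 1 N₀ →
        BilinBoundedBy (fun m n => quadEigenvalue d χ k (c * m * n)) W Z
          (C * (c : ℝ) ^ (1 + ε) * ((M₀ : ℝ) + N₀) ^ (1 / 12 : ℝ) * ((M₀ : ℝ) * N₀) ^ (11 / 12 + ε)))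
    {d : ℕ} (hd : 1 ≤ d) (χ : MulChar (GaussQuot (4 * d)) ℂ) (k : ℤ) {X c : ℕ} (hc : 1 ≤ c)
    (hcX : c ≤ X) (g : ℕ → ℂ) (hg0 : ∀ n, X < n → g n = 0) (P : ℝ) (r z : ℕ)
    {dd : ℕ} (hdd : 1 ≤ dd) :
    ‖∑ m ∈ Icc 1 (Nat.sqrt (X / c)), ∑ n ∈ Icc 1 (Nat.sqrt (X / c)),
        (if IsPlusAdm r dd m ∧ IsMinusAdm r dd n ∧ dd * m * n ∈ smoothSqf (X / c) z then
          coefC c P (dd * m * n) * g (c * (dd * m * n)) * quadEigenvalue d χ k (c * (dd * m * n))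
        else 0)‖ ≤
      weightVariation g X * Real.log (6 * X) *
        (C * ((c * dd : ℕ) : ℝ) ^ (1 + ε) * (((Nat.sqrt (X / c) : ℕ) : ℝ) + (Nat.sqrt (X / c) : ℕ)) ^ (1 / 12 : ℝ) *
          (((Nat.sqrt (X / c) : ℕ) : ℝ) * (Nat.sqrt (X / c) : ℕ)) ^ (11 / 12 + ε)) := by
  set x := X / c with hx
  set s := Nat.sqrt x with hs
  have hX : 1 ≤ X := hc.trans hcX
  have hx1 : 1 ≤ x := Nat.div_pos hcX hc
  have hs1 : 1 ≤ s := Nat.sqrt_pos.mpr hx1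
  have hW1 : ∀ m ∈ Icc 1 s, 1 ≤ m := fun m hm => (mem_Icc.mp hm).1
  -- the kernel chain
  have hK₀ := hC d hd χ k (c * dd) (Nat.mul_pos hc hdd) s s hs1 hs1 (Icc 1 s) (Icc 1 s)
    (subset_refl _) (subset_refl _)
  have hK₁ := hK₀.bvWeight (u := fun m => c * dd * m) (v := id)
    (fun m hm => Nat.mul_pos (Nat.mul_pos hc hdd) (hW1 m hm)) (fun n hn => hW1 n hn) g hX hg0
  set B : ℝ := weightVariation g X * Real.log (6 * X) *
      (C * ((c * dd : ℕ) : ℝ) ^ (1 + ε) * ((s : ℝ) + s) ^ (1 / 12 : ℝ) * ((s : ℝ) * s) ^ (11 / 12 + ε))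
    with hB
  have hB0 : 0 ≤ B := hK₁.nonneg
  by_cases hsq : Squarefree dd
  swap
  · -- `dd` not squarefree: every term vanishes
    rw [sum_eq_zero fun m _ => sum_eq_zero fun n _ => ?_, norm_zero]
    · exact hB0
    rw [if_neg]
    rintro ⟨-, -, hmem⟩
    rw [mem_smoothSqf] at hmem
    exact hsq (Nat.squarefree_mul_iff.mp (Nat.squarefree_mul_iff.mp hmem.2.1).2.1).2.1
  -- `dd` squarefree: the summand factors
  have hdd0 : dd ≠ 0 := by omega
  set a : ℕ → ℂ := fun m => (if IsPlusAdm r dd m then 1 else 0) * (coefC c P m * smoothInd z m) with ha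
  set b : ℕ → ℂ := fun n => (if IsMinusAdm r dd n then 1 else 0) * (coefC c P n * smoothInd z n) with hb
  set κ : ℂ := coefC c P dd * smoothInd z dd with hκ
  have ha1 : ∀ m, ‖a m‖ ≤ 1 := fun m => by
    rw [ha]; simp only; rw [norm_mul, norm_mul]
    refine mul_le_one₀ (by split_ifs <;> simp) (by positivity)
      (mul_le_one₀ (norm_coefC_le _ _ _) (norm_nonneg _) (norm_smoothInd_le _ _))
  have hb1 : ∀ n, ‖b n‖ ≤ 1 := fun n => by
    rw [hb]; simp only; rw [norm_mul, norm_mul]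
    refine mul_le_one₀ (by split_ifs <;> simp) (by positivity)
      (mul_le_one₀ (norm_coefC_le _ _ _) (norm_nonneg _) (norm_smoothInd_le _ _))
  have hκ1 : ‖κ‖ ≤ 1 := by
    rw [hκ, norm_mul]; exact mul_le_one₀ (norm_coefC_le _ _ _) (norm_nonneg _) (norm_smoothInd_le _ _)
  have hpt : ∀ m ∈ Icc 1 s, ∀ n ∈ Icc 1 s,
      (if IsPlusAdm r dd m ∧ IsMinusAdm r dd n ∧ dd * m * n ∈ smoothSqf x z then
          coefC c P (dd * m * n) * g (c * (dd * m * n)) * quadEigenvalue d χ k (c * (dd * m * n))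
        else 0) =
        a m * b n * (κ * (g (c * dd * m * id n) * quadEigenvalue d χ k (c * dd * m * n))) := by
    intro m hm n hn
    have hm1 := hW1 m hm
    have hn1 := hW1 n hn
    rw [ha, hb, hκ]
    simp only [id]
    by_cases hadm : IsPlusAdm r dd m ∧ IsMinusAdm r dd n
    · obtain ⟨hpm, hmn⟩ := hadm
      rw [if_pos hpm, if_pos hmn, one_mul, one_mul]
      have hm0 : m ≠ 0 := by omega
      have hn0 : n ≠ 0 := by omega
      have hcop_dm : Nat.Coprime dd m := coprime_of_primeFactors_disjoint hdd0 hm0 hpm.disjoint.symm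
      have hcop_dn : Nat.Coprime dd n := coprime_of_primeFactors_disjoint hdd0 hn0 hmn.disjoint.symm
      have hcop_mn : Nat.Coprime m n := coprime_of_primeFactors_disjoint hm0 hn0 (disjoint_of_adm hpm hmn)
      have hsqf : Squarefree (dd * m * n) := squarefree_of_adm hsq hpm hmn
      -- factor the coefficient and the smooth indicator
      have hcoef : coefC c P (dd * m * n) = coefC c P dd * coefC c P m * coefC c P n := by
        rw [coefC_mul_of_coprime c P (mul_ne_zero hdd0 hm0) hn0 (Nat.Coprime.mul_left hcop_dn hcop_mn),
          coefC_mul_of_coprime c P hdd0 hm0 hcop_dm]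
      have hsmooth : smoothInd z (dd * m * n) = smoothInd z dd * smoothInd z m * smoothInd z n := by
        rw [smoothInd_mul z (mul_ne_zero hdd0 hm0) hn0, smoothInd_mul z hdd0 hm0]
      by_cases hle : dd * m * n ≤ x
      · have hmem : (dd * m * n ∈ smoothSqf x z) ↔ ∀ p ∈ (dd * m * n).primeFactors, p < z := by
          rw [mem_smoothSqf]
          exact ⟨fun h => h.2.2, fun h => ⟨⟨Nat.mul_pos (Nat.mul_pos hdd hm1) hn1, hle⟩, hsqf, h⟩⟩
        by_cases hsm : ∀ p ∈ (dd * m * n).primeFactors, p < z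
        · rw [if_pos ⟨hpm, hmn, hmem.mpr hsm⟩, show c * (dd * m * n) = c * dd * m * n by ring, hcoef]
          have h1 : smoothInd z (dd * m * n) = 1 := if_pos hsm
          rw [hsmooth] at h1
          calc coefC c P dd * coefC c P m * coefC c P n * g (c * dd * m * n) *
                quadEigenvalue d χ k (c * dd * m * n)
              = coefC c P dd * coefC c P m * coefC c P n * (smoothInd z dd * smoothInd z m * smoothInd z n) *
                  g (c * dd * m * n) * quadEigenvalue d χ k (c * dd * m * n) := by rw [h1, mul_one]
            _ = _ := by ring
        · rw [if_neg (fun h => hsm (hmem.mp h.2.2))]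
          have h0 : smoothInd z (dd * m * n) = 0 := if_neg hsm
          rw [hsmooth] at h0
          have : coefC c P dd * smoothInd z dd * (coefC c P m * smoothInd z m) * (coefC c P n * smoothInd z n) =
              coefC c P dd * coefC c P m * coefC c P n * (smoothInd z dd * smoothInd z m * smoothInd z n) := by
            ring
          calc (0 : ℂ) = coefC c P dd * coefC c P m * coefC c P n *
                (smoothInd z dd * smoothInd z m * smoothInd z n) *
                (g (c * dd * m * n) * quadEigenvalue d χ k (c * dd * m * n)) := by rw [h0]; ring
            _ = _ := by ring
      · -- beyond `x`: the weight vanishes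
        push Not at hle
        rw [if_neg (fun h => ?_)]
        · have hbig : X < c * dd * m * n := by
            have h1 : X / c < dd * m * n := hle
            rw [Nat.div_lt_iff_lt_mul (by omega)] at h1
            calc X < dd * m * n * c := h1
              _ = c * dd * m * n := by ring
          rw [hg0 _ hbig]; ring
        · have := (mem_smoothSqf.mp h.2.2).1.2
          omega
    · -- not admissible: both sides vanish
      rw [if_neg (fun h => hadm ⟨h.1, h.2.1⟩)]
      rcases not_and_or.mp hadm with h | h
      · rw [if_neg h]; ring
      · rw [if_neg h]; ring
  rw [sum_congr rfl fun m hm => sum_congr rfl fun n hn => hpt m hm n hn]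
  have hval := (hK₁.const_mul κ) a b ha1 hb1
  refine hval.trans ?_
  calc ‖κ‖ * (weightVariation g X * Real.log (6 * ((X : ℕ) : ℝ)) *
        (C * ((c * dd : ℕ) : ℝ) ^ (1 + ε) * ((s : ℝ) + s) ^ (1 / 12 : ℝ) * ((s : ℝ) * s) ^ (11 / 12 + ε)))
      ≤ 1 * B := by rw [hB]; exact mul_le_mul_of_nonneg_right hκ1 hB0
    _ = B := one_mul B

/-! ### The small range: the piece `T(c)` (both primes large), one dyadic block -/

/-- **One dyadic block of the bilinear form `T(c)`** (§25: "Similarly for the second double sum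
Proposition 23.1 also gives `T(c) ≪ N^{1-1/12r²+ε}`"): for `1 ≤ c ≤ X`, `x = X/c`, `P₁ ≥ 1`, the
block `P₁ < p ≤ 2P₁` of the second sum of Proposition 24.2 applied to `f_c` has norm at most
`V(g) log(6X) · C c^{1+ε} (2P₁ + x/P₁)^{1/12} (2P₁ · x/P₁)^{11/12+ε} + 2T · (x/P₁)`, `T` a uniform
bound for `τ(n)`, `n ≤ X` (the pairs `p ∣ q` removed by `BilinBoundedBy.coprime` with `B₀ = 1`).
[cite: FriedlanderIwaniecAnnals1998, §25 (the bound for `T(c)`)] -/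
theorem norm_sigma2_block_le {ε : ℝ} {C : ℝ}
    (hC : ∀ d : ℕ, 1 ≤ d → ∀ χ : MulChar (GaussQuot (4 * d)) ℂ, ∀ k : ℤ,
      ∀ c : ℕ, 1 ≤ c → ∀ M₀ N₀ : ℕ, 1 ≤ M₀ → 1 ≤ N₀ → ∀ W Z : Finset ℕ, W ⊆ Icc 1 M₀ → Z ⊆ Icc 1 N₀ →
        BilinBoundedBy (fun m n => quadEigenvalue d χ k (c * m * n)) W Z
          (C * (c : ℝ) ^ (1 + ε) * ((M₀ : ℝ) + N₀) ^ (1 / 12 : ℝ) * ((M₀ : ℝ) * N₀) ^ (11 / 12 + ε)))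
    {d : ℕ} (hd : 1 ≤ d) (χ : MulChar (GaussQuot (4 * d)) ℂ) (k : ℤ) {X c : ℕ} (hc : 1 ≤ c)
    (hcX : c ≤ X) (g : ℕ → ℂ) (hg0 : ∀ n, X < n → g n = 0) (hg1 : ∀ n, ‖g n‖ ≤ 1) (P : ℝ) (z : ℕ)
    {T : ℝ} (hT : ∀ n, 1 ≤ n → n ≤ X → ((Nat.divisors n).card : ℝ) ≤ T) {P₁ : ℕ} (hP₁ : 1 ≤ P₁)
    (hP₁x : P₁ ≤ X / c) :
    ‖∑ p ∈ (primesIcc z (X / c)).filter (fun p => P₁ < p ∧ p ≤ 2 * P₁),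
        ∑ q ∈ (Icc 1 (X / c)).filter (z ≤ ·),
          (if p * q ∈ sqfLE (X / c) then
            ((1 + roughCount z q : ℕ) : ℂ)⁻¹ * (coefC c P (p * q) * g (c * (p * q)) *
              quadEigenvalue d χ k (c * (p * q))) else 0)‖ ≤
      weightVariation g X * Real.log (6 * X) *
        (C * (c : ℝ) ^ (1 + ε) * (((2 * P₁ : ℕ) : ℝ) + ((X / c / P₁ : ℕ) : ℝ)) ^ (1 / 12 : ℝ) *
          (((2 * P₁ : ℕ) : ℝ) * ((X / c / P₁ : ℕ) : ℝ)) ^ (11 / 12 + ε)) +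
      2 * T * ((X / c / P₁ : ℕ) : ℝ) := by
  set x := X / c with hx
  have hX : 1 ≤ X := hc.trans hcX
  have hN₀ : 1 ≤ x / P₁ := Nat.div_pos hP₁x hP₁
  set W : Finset ℕ := (primesIcc z x).filter (fun p => P₁ < p ∧ p ≤ 2 * P₁) with hW
  set Z : Finset ℕ := (Icc 1 (x / P₁)).filter (z ≤ ·) with hZ
  have hWsub : W ⊆ Icc 1 (2 * P₁) := fun p hp => by
    rw [hW, mem_filter] at hp; rw [mem_Icc]; omega
  have hWsub' : W ⊆ Ioc P₁ (2 * P₁) := fun p hp => by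
    rw [hW, mem_filter] at hp; rw [mem_Ioc]; omega
  have hZsub : Z ⊆ Icc 1 (x / P₁) := filter_subset _ _
  have hWp : ∀ p ∈ W, p.Prime ∧ P₁ < p ∧ p ≤ x := fun p hp => by
    rw [hW, mem_filter, primesIcc, mem_filter, mem_Icc] at hp
    exact ⟨hp.1.2, hp.2.1, hp.1.1.2⟩
  have hW1 : ∀ p ∈ W, 1 ≤ p := fun p hp => (hWp p hp).1.one_lt.le
  have hZ1 : ∀ q ∈ Z, 1 ≤ q := fun q hq => by
    rw [hZ, mem_filter, mem_Icc] at hq; exact hq.1.1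
  -- Step 1: shrink the `q`-range
  have hshrink : ∀ p ∈ W, ∑ q ∈ (Icc 1 x).filter (z ≤ ·),
      (if p * q ∈ sqfLE x then ((1 + roughCount z q : ℕ) : ℂ)⁻¹ *
        (coefC c P (p * q) * g (c * (p * q)) * quadEigenvalue d χ k (c * (p * q))) else 0) =
      ∑ q ∈ Z, (if p * q ∈ sqfLE x then ((1 + roughCount z q : ℕ) : ℂ)⁻¹ *
        (coefC c P (p * q) * g (c * (p * q)) * quadEigenvalue d χ k (c * (p * q))) else 0) := by
    intro p hp
    obtain ⟨-, hpP, -⟩ := hWp p hp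
    refine (sum_subset (fun q hq => ?_) (fun q hq hq' => ?_)).symm
    · rw [hZ, mem_filter, mem_Icc] at hq
      rw [mem_filter, mem_Icc]
      exact ⟨⟨hq.1.1, hq.1.2.trans (Nat.div_le_self _ _)⟩, hq.2⟩
    · rw [mem_filter, mem_Icc] at hq
      rw [hZ, mem_filter, mem_Icc, not_and', not_and, not_le] at hq'
      have hlt : x / P₁ < q := hq' hq.2 hq.1.1
      rw [if_neg]
      intro hmem
      rw [mem_sqfLE] at hmem
      have h1 : x < q * P₁ := (Nat.div_lt_iff_lt_mul (by omega)).mp hlt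
      have h2 : q * P₁ ≤ p * q := by rw [mul_comm q]; exact Nat.mul_le_mul_right q hpP.le
      omega
  rw [sum_congr rfl hshrink]
  -- Step 2: the pointwise factorisation
  set a : ℕ → ℂ := fun p => coefC c P p with ha
  set b : ℕ → ℂ := fun q => ((1 + roughCount z q : ℕ) : ℂ)⁻¹ * (if Squarefree q then 1 else 0) * coefC c P q
    with hb
  have ha1 : ∀ p, ‖a p‖ ≤ 1 := fun p => norm_coefC_le _ _ _
  have hb1 : ∀ q, ‖b q‖ ≤ 1 := fun q => by
    rw [hb]; simp only; rw [norm_mul, norm_mul]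
    refine mul_le_one₀ (mul_le_one₀ ?_ (norm_nonneg _) (by split_ifs <;> simp)) (norm_nonneg _)
      (norm_coefC_le _ _ _)
    rw [norm_inv, Complex.norm_natCast]
    exact inv_le_one_of_one_le₀ (by exact_mod_cast Nat.le_add_right 1 _)
  have hpt : ∀ p ∈ W, ∀ q ∈ Z,
      (if p * q ∈ sqfLE x then ((1 + roughCount z q : ℕ) : ℂ)⁻¹ *
        (coefC c P (p * q) * g (c * (p * q)) * quadEigenvalue d χ k (c * (p * q))) else 0) =
      a p * b q * ((if Nat.Coprime (id p) (id q) then (1 : ℂ) else 0) *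
        (g (c * p * id q) * quadEigenvalue d χ k (c * p * q))) := by
    intro p hp q hq
    obtain ⟨hpp, -, -⟩ := hWp p hp
    have hq1 := hZ1 q hq
    rw [ha, hb]
    simp only [id]
    have hmul : c * (p * q) = c * p * q := by ring
    by_cases hcop : Nat.Coprime p q
    · rw [if_pos hcop]
      by_cases hsq : Squarefree q
      · rw [if_pos hsq]
        have hsqf : Squarefree (p * q) := Nat.squarefree_mul_iff.mpr ⟨hcop, hpp.squarefree, hsq⟩
        by_cases hle : p * q ≤ x
        · rw [if_pos (mem_sqfLE.mpr ⟨⟨Nat.mul_pos hpp.pos hq1, hle⟩, hsqf⟩),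
            coefC_mul_of_coprime c P hpp.ne_zero (by omega) hcop, hmul]
          ring
        · push Not at hle
          rw [if_neg (fun h => by have := (mem_sqfLE.mp h).1.2; omega)]
          have hbig : X < c * p * q := by
            have h1 : X / c < p * q := hle
            rw [Nat.div_lt_iff_lt_mul (by omega)] at h1
            calc X < p * q * c := h1
              _ = c * p * q := by ring
          rw [hg0 _ hbig]; ring
      · rw [if_neg hsq, if_neg (fun h => hsq (Nat.squarefree_mul_iff.mp (mem_sqfLE.mp h).2).2.2)]
        ring
    · rw [if_neg hcop, if_neg (fun h => hcop (Nat.squarefree_mul_iff.mp (mem_sqfLE.mp h).2).1)]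
      ring
  rw [sum_congr rfl fun p hp => sum_congr rfl fun q hq => hpt p hp q hq]
  -- Step 3: the kernel chain
  have hK₀ := hC d hd χ k c hc (2 * P₁) (x / P₁) (by omega) hN₀ W Z hWsub hZsub
  have hK₁ := hK₀.bvWeight (u := fun p => c * p) (v := id)
    (fun p hp => Nat.mul_pos hc (hW1 p hp)) hZ1 g hX hg0
  have hK₂ := hK₁.coprime (u := id) (id : ℕ → ℕ) hW1 1
  have hval := hK₂ a b ha1 hb1
  refine hval.trans ?_
  rw [Nat.cast_one, one_mul]
  refine add_le_add (le_of_eq (by rfl)) ?_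
  -- Step 4: the pairs `p ∣ q`
  have hT0 : 0 ≤ T := le_trans (by positivity) (hT 1 le_rfl hX)
  have hterm : ∀ p ∈ W, ∀ q ∈ Z,
      (if 1 < Nat.gcd (id p) (id q) then ((Nat.gcd (id p) (id q)).divisors.card : ℝ) *
          ‖g (c * p * id q) * quadEigenvalue d χ k (c * p * q)‖ else 0) ≤
        2 * T * (if p ∣ q then (1 : ℝ) else 0) := by
    intro p hp q hq
    obtain ⟨hpp, -, -⟩ := hWp p hp
    have hq1 := hZ1 q hq
    simp only [id]
    have hg1' : 1 ≤ Nat.gcd p q := Nat.gcd_pos_of_pos_left q hpp.pos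
    have hiff : 1 < Nat.gcd p q ↔ p ∣ q := by
      rw [← not_iff_not, show (¬ 1 < Nat.gcd p q) ↔ Nat.gcd p q = 1 by omega]
      exact Nat.coprime_iff_gcd_eq_one.symm.trans hpp.coprime_iff_not_dvd
    by_cases hdvd : p ∣ q
    · rw [if_pos (hiff.mpr hdvd), if_pos hdvd, mul_one, Nat.gcd_eq_left hdvd, hpp.divisors,
        card_pair hpp.one_lt.ne, Nat.cast_ofNat]
      refine mul_le_mul_of_nonneg_left ?_ (by norm_num)
      by_cases hle : c * p * q ≤ X
      · rw [norm_mul]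
        calc ‖g (c * p * q)‖ * ‖quadEigenvalue d χ k (c * p * q)‖
            ≤ 1 * ((c * p * q).divisors.card : ℝ) :=
              mul_le_mul (hg1 _) (norm_quadEigenvalue_le d hd χ k _) (norm_nonneg _) zero_le_one
          _ ≤ T := by
              rw [one_mul]
              exact hT _ (Nat.mul_pos (Nat.mul_pos hc hpp.pos) hq1) hle
      · push Not at hle
        rw [hg0 _ hle, zero_mul, norm_zero]; exact hT0
    · rw [if_neg (fun h => hdvd (hiff.mp h)), if_neg hdvd, mul_zero]
  -- Step 5: counting the pairs `p ∣ q`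
  have hcount : ∀ p ∈ W, ∑ q ∈ Z, (if p ∣ q then (1 : ℝ) else 0) ≤ ((x / P₁ / (P₁ + 1) : ℕ) : ℝ) := by
    intro p hp
    obtain ⟨hpp, hpP, -⟩ := hWp p hp
    rw [← sum_filter, sum_const, nsmul_eq_mul, mul_one]
    have h1 : (Z.filter (p ∣ ·)).card ≤ ((Ioc 0 (x / P₁)).filter (p ∣ ·)).card := by
      refine card_le_card fun q hq => ?_
      rw [mem_filter] at hq ⊢
      rw [hZ, mem_filter, mem_Icc] at hq
      exact ⟨mem_Ioc.mpr ⟨hq.1.1.1, hq.1.1.2⟩, hq.2⟩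
    rw [Nat.Ioc_filter_dvd_card_eq_div] at h1
    have h2 : x / P₁ / p ≤ x / P₁ / (P₁ + 1) := Nat.div_le_div_left (by omega) (by omega)
    exact_mod_cast h1.trans h2
  calc ∑ p ∈ W, ∑ q ∈ Z, (if 1 < Nat.gcd (id p) (id q) then
          ((Nat.gcd (id p) (id q)).divisors.card : ℝ) * ‖g (c * p * id q) * quadEigenvalue d χ k (c * p * q)‖ else 0)
      ≤ ∑ p ∈ W, ∑ q ∈ Z, 2 * T * (if p ∣ q then (1 : ℝ) else 0) :=
        sum_le_sum fun p hp => sum_le_sum fun q hq => hterm p hp q hq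
    _ = 2 * T * ∑ p ∈ W, ∑ q ∈ Z, (if p ∣ q then (1 : ℝ) else 0) := by
        rw [mul_sum]; simp_rw [mul_sum]
    _ ≤ 2 * T * ∑ p ∈ W, ((x / P₁ / (P₁ + 1) : ℕ) : ℝ) :=
        mul_le_mul_of_nonneg_left (sum_le_sum hcount) (by positivity)
    _ = 2 * T * ((W.card : ℝ) * ((x / P₁ / (P₁ + 1) : ℕ) : ℝ)) := by rw [sum_const, nsmul_eq_mul]
    _ ≤ 2 * T * ((x / P₁ : ℕ) : ℝ) := by
        refine mul_le_mul_of_nonneg_left ?_ (by positivity)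
        have hWc : W.card ≤ P₁ := by
          have := card_le_card hWsub'
          rw [Nat.card_Ioc] at this
          omega
        have hnat : P₁ * (x / P₁ / (P₁ + 1)) ≤ x / P₁ := by
          calc P₁ * (x / P₁ / (P₁ + 1)) ≤ (P₁ + 1) * (x / P₁ / (P₁ + 1)) :=
                Nat.mul_le_mul_right _ (Nat.le_succ P₁)
            _ ≤ x / P₁ := by rw [mul_comm]; exact Nat.div_mul_le_self (x / P₁) (P₁ + 1)
        calc (W.card : ℝ) * ((x / P₁ / (P₁ + 1) : ℕ) : ℝ) ≤ (P₁ : ℝ) * ((x / P₁ / (P₁ + 1) : ℕ) : ℝ) := by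
              gcongr
          _ ≤ ((x / P₁ : ℕ) : ℝ) := by exact_mod_cast hnat

/-! ### The small range: the piece `S(c)` — a sum over primes via Theorem 2^ψ -/

/-- `‖Σ_{n ≤ t, n prime} (log n) λ(c'n)‖ ≤ F_ψ x^ϑ + T₂ · 2√x log x` for `t ≤ x`: Theorem 2^ψ
(`‖Σ_{n ≤ t} Λ(n) λ(c'n)‖ ≤ F_ψ t^ϑ`, `t ≥ 2`) minus the prime powers, which contribute at most
`T₂ (ψ(t) - θ(t)) ≤ T₂ · 2√t log t` [Mathlib: `Chebyshev.psi_sub_theta_le`] when `|λ(c'n)| ≤ T₂`.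
[cite: FriedlanderIwaniecAnnals1998, §25 (the bound for `S(c)`)] -/
theorem norm_sum_prime_log_mul_le {d : ℕ} (χ : MulChar (GaussQuot (4 * d)) ℂ) (k : ℤ) {c' : ℕ}
    {ϑ Fψ : ℝ} (hϑ : 0 ≤ ϑ) (hF : 0 ≤ Fψ)
    (hψ : ∀ t : ℝ, 2 ≤ t → ‖vonMangoldtEigenSum d χ k c' t‖ ≤ Fψ * t ^ ϑ)
    {x : ℕ} (hx : 1 ≤ x) {T₂ : ℝ} (hT₂ : ∀ n, 1 ≤ n → n ≤ x → ‖quadEigenvalue d χ k (c' * n)‖ ≤ T₂)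
    {t : ℕ} (ht : t ≤ x) :
    ‖∑ n ∈ Ioc 0 t, (if n.Prime then ((Real.log n : ℝ) : ℂ) * quadEigenvalue d χ k (c' * n) else 0)‖ ≤
      Fψ * (x : ℝ) ^ ϑ + T₂ * (2 * Real.sqrt x * Real.log x) := by
  have hT0 : 0 ≤ T₂ := le_trans (norm_nonneg _) (hT₂ 1 le_rfl hx)
  have hx0 : (0 : ℝ) < x := by exact_mod_cast hx
  have hx1 : (1 : ℝ) ≤ x := by exact_mod_cast hx
  -- split `[prime] log n λ = Λ(n) λ - [¬ prime] Λ(n) λ`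
  have hsplit : ∀ n, (if n.Prime then ((Real.log n : ℝ) : ℂ) * quadEigenvalue d χ k (c' * n) else 0) =
      ((Λ n : ℝ) : ℂ) * quadEigenvalue d χ k (c' * n) -
        (if ¬ n.Prime then ((Λ n : ℝ) : ℂ) * quadEigenvalue d χ k (c' * n) else 0) := by
    intro n
    by_cases hp : n.Prime
    · rw [if_pos hp, if_neg (not_not.mpr hp), ArithmeticFunction.vonMangoldt_apply_prime hp, sub_zero]
    · rw [if_neg hp, if_pos hp, sub_self]
  simp_rw [hsplit]
  rw [sum_sub_distrib]
  refine (norm_sub_le _ _).trans (add_le_add ?_ ?_)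
  · -- Theorem 2^ψ
    rcases lt_or_ge t 2 with ht2 | ht2
    · -- `t ≤ 1`: the sum vanishes
      have : ∑ n ∈ Ioc 0 t, ((Λ n : ℝ) : ℂ) * quadEigenvalue d χ k (c' * n) = 0 := by
        refine sum_eq_zero fun n hn => ?_
        rw [mem_Ioc] at hn
        have : n = 1 := by omega
        subst this
        rw [ArithmeticFunction.vonMangoldt_apply_one]; simp
      rw [this, norm_zero]; positivity
    · have ht2' : (2 : ℝ) ≤ t := by exact_mod_cast ht2
      have h := hψ t ht2'
      have hId : vonMangoldtEigenSum d χ k c' t = ∑ n ∈ Ioc 0 t, ((Λ n : ℝ) : ℂ) * quadEigenvalue d χ k (c' * n) := by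
        rw [vonMangoldtEigenSum, Nat.floor_natCast]
        refine sum_congr (by ext n; simp only [mem_Icc, mem_Ioc]; omega) fun _ _ => rfl
      rw [hId] at h
      refine h.trans (mul_le_mul_of_nonneg_left ?_ hF)
      exact Real.rpow_le_rpow (by positivity) (by exact_mod_cast ht) hϑ
  · -- the prime powers
    have ht0 : (t : ℝ) ≤ x := by exact_mod_cast ht
    calc ‖∑ n ∈ Ioc 0 t, (if ¬ n.Prime then ((Λ n : ℝ) : ℂ) * quadEigenvalue d χ k (c' * n) else 0)‖
        ≤ ∑ n ∈ Ioc 0 t, (if ¬ n.Prime then Λ n * T₂ else 0) := by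
          refine (norm_sum_le _ _).trans (sum_le_sum fun n hn => ?_)
          rw [mem_Ioc] at hn
          by_cases hp : n.Prime
          · rw [if_neg (not_not.mpr hp), if_neg (not_not.mpr hp), norm_zero]
          · rw [if_pos hp, if_pos hp, norm_mul, Complex.norm_real,
              Real.norm_of_nonneg ArithmeticFunction.vonMangoldt_nonneg]
            exact mul_le_mul_of_nonneg_left (hT₂ n hn.1 (hn.2.trans ht)) ArithmeticFunction.vonMangoldt_nonneg
      _ = T₂ * ∑ n ∈ (Ioc 0 t).filter (fun n => ¬ n.Prime), Λ n := by
          rw [sum_filter, mul_sum]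
          refine sum_congr rfl fun n _ => ?_
          split_ifs <;> ring
      _ = T₂ * (Chebyshev.psi t - Chebyshev.theta t) := by
          rw [Chebyshev.psi_sub_theta_eq_sum_not_prime, Nat.floor_natCast]
      _ ≤ T₂ * (2 * Real.sqrt x * Real.log x) := by
          refine mul_le_mul_of_nonneg_left ?_ hT0
          rcases Nat.eq_zero_or_pos t with rfl | htpos
          · rw [Nat.cast_zero, Chebyshev.psi, Chebyshev.theta]
            simp only [Nat.floor_zero]
            simp only [Ioc_self, sum_empty, Finset.filter_empty, sub_self]
            have := Real.log_nonneg hx1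
            positivity
          · have ht1 : (1 : ℝ) ≤ t := by exact_mod_cast htpos
            calc Chebyshev.psi t - Chebyshev.theta t ≤ 2 * Real.sqrt t * Real.log t :=
                  Chebyshev.psi_sub_theta_le ht1
              _ ≤ 2 * Real.sqrt x * Real.log x := by
                  have h1 : Real.sqrt t ≤ Real.sqrt x := Real.sqrt_le_sqrt ht0
                  have h2 : Real.log t ≤ Real.log x := Real.log_le_log (by positivity) ht0
                  have h3 : 0 ≤ Real.log t := Real.log_nonneg ht1
                  have h4 : 0 ≤ Real.sqrt x := Real.sqrt_nonneg x
                  nlinarith [Real.sqrt_nonneg t]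

/-- The set of `n` at which the indicator `[P ≤ n]` jumps has at most one element, so the indicator
has total variation `≤ 1`. [folklore] -/
private theorem sum_norm_indicator_step_le (P : ℝ) (S : Finset ℕ) :
    ∑ n ∈ S, ‖((if P ≤ ((n + 1 : ℕ) : ℝ) then (1 : ℂ) else 0) - (if P ≤ (n : ℝ) then (1 : ℂ) else 0))‖ ≤ 1 := by
  have hpt : ∀ n, ‖((if P ≤ ((n + 1 : ℕ) : ℝ) then (1 : ℂ) else 0) - (if P ≤ (n : ℝ) then (1 : ℂ) else 0))‖ =
      if (P ≤ ((n + 1 : ℕ) : ℝ) ∧ ¬ P ≤ (n : ℝ)) then (1 : ℝ) else 0 := by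
    intro n
    by_cases h1 : P ≤ ((n + 1 : ℕ) : ℝ)
    · by_cases h2 : P ≤ (n : ℝ)
      · rw [if_pos h1, if_pos h2, if_neg (fun h => h.2 h2)]; simp
      · rw [if_pos h1, if_neg h2, if_pos ⟨h1, h2⟩]; simp
    · have h2 : ¬ P ≤ (n : ℝ) := fun h => h1 (h.trans (by push_cast; linarith))
      rw [if_neg h1, if_neg h2, if_neg (fun h => h1 h.1)]; simp
  simp_rw [hpt]
  rw [← sum_filter, sum_const, nsmul_eq_mul, mul_one]
  have : (S.filter fun n => P ≤ ((n + 1 : ℕ) : ℝ) ∧ ¬ P ≤ (n : ℝ)).card ≤ 1 := by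
    refine Finset.card_le_one.mpr fun a ha b hb => ?_
    rw [mem_filter] at ha hb
    by_contra hne
    rcases lt_or_gt_of_ne hne with h | h
    · have : ((a + 1 : ℕ) : ℝ) ≤ b := by exact_mod_cast h
      exact hb.2.2 (ha.2.1.trans this)
    · have : ((b + 1 : ℕ) : ℝ) ≤ a := by exact_mod_cast h
      exact ha.2.2 (hb.2.1.trans this)
  exact_mod_cast this

/-- The variation of `n ↦ 1/log n` on `[1, x)`: at most `2/log 2` (one jump at `n = 1`, where
`1/log 1 = 0` by convention, then a decreasing sequence). [folklore] -/
private theorem sum_norm_inv_log_step_le (x : ℕ) :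
    ∑ n ∈ Ico 1 x, ‖(((Real.log ((n + 1 : ℕ) : ℝ))⁻¹ : ℝ) : ℂ) - (((Real.log (n : ℝ))⁻¹ : ℝ) : ℂ)‖ ≤
      2 / Real.log 2 := by
  have hlog2 : 0 < Real.log 2 := Real.log_pos (by norm_num)
  rcases le_or_gt x 1 with hx | hx
  · rw [Finset.Ico_eq_empty (by omega), sum_empty]; positivity
  -- split off `n = 1`
  have hsplit : Ico 1 x = insert 1 (Ico 2 x) := by
    ext n; simp only [mem_Ico, mem_insert]; omega
  rw [hsplit, sum_insert (by simp)]
  have h1 : ‖(((Real.log ((1 + 1 : ℕ) : ℝ))⁻¹ : ℝ) : ℂ) - (((Real.log ((1 : ℕ) : ℝ))⁻¹ : ℝ) : ℂ)‖ = 1 / Real.log 2 := by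
    rw [show ((1 + 1 : ℕ) : ℝ) = 2 by norm_num, show ((1 : ℕ) : ℝ) = 1 by norm_num, Real.log_one, inv_zero,
      Complex.ofReal_zero, sub_zero, Complex.norm_real, Real.norm_of_nonneg (inv_nonneg.mpr hlog2.le), one_div]
  rw [h1]
  -- the decreasing part telescopes
  have hterm : ∀ n ∈ Ico 2 x, ‖(((Real.log ((n + 1 : ℕ) : ℝ))⁻¹ : ℝ) : ℂ) - (((Real.log (n : ℝ))⁻¹ : ℝ) : ℂ)‖ =
      (Real.log (n : ℝ))⁻¹ - (Real.log ((n + 1 : ℕ) : ℝ))⁻¹ := by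
    intro n hn
    rw [mem_Ico] at hn
    have hn2 : (2 : ℝ) ≤ n := by exact_mod_cast hn.1
    have hlogn : 0 < Real.log (n : ℝ) := Real.log_pos (by linarith)
    have hmono : (Real.log ((n + 1 : ℕ) : ℝ))⁻¹ ≤ (Real.log (n : ℝ))⁻¹ := by
      refine inv_anti₀ hlogn (Real.log_le_log (by linarith) ?_)
      push_cast; linarith
    rw [← Complex.ofReal_sub, Complex.norm_real, Real.norm_eq_abs, abs_sub_comm, abs_of_nonneg (by linarith)]
  rw [sum_congr rfl hterm]
  have htel : ∀ y : ℕ, 2 ≤ y → ∑ n ∈ Ico 2 y, ((Real.log (n : ℝ))⁻¹ - (Real.log ((n + 1 : ℕ) : ℝ))⁻¹) =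
      (Real.log 2)⁻¹ - (Real.log (y : ℝ))⁻¹ := by
    intro y hy
    induction y, hy using Nat.le_induction with
    | base => simp
    | succ y hy ih => rw [sum_Ico_succ_top hy, ih]; push_cast; ring
  rw [htel x (by omega)]
  have hx2 : (2 : ℝ) ≤ x := by exact_mod_cast (by omega : 2 ≤ x)
  have : 0 ≤ (Real.log (x : ℝ))⁻¹ := inv_nonneg.mpr (Real.log_nonneg (by linarith))
  simp only [div_eq_mul_inv]
  linarith

/-- A sum of the variation of a weight vanishing beyond `X` over any initial segment is at most
`V(g)`. [cite: FriedlanderIwaniecAnnals1998, §25] -/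
theorem sum_Ico_norm_sub_le_weightVariation (g : ℕ → ℂ) {X : ℕ} (hg0 : ∀ n, X < n → g n = 0) (U : ℕ) :
    ∑ j ∈ Ico 1 U, ‖g (j + 1) - g j‖ ≤ weightVariation g X := by
  rw [weightVariation]
  have hzero : ∀ j ∈ Ico 1 U, j ∉ Icc 1 X → ‖g (j + 1) - g j‖ = 0 := by
    intro j hj hj'
    rw [mem_Ico] at hj
    rw [mem_Icc, not_and, not_le] at hj'
    have hjX := hj' hj.1
    rw [hg0 j hjX, hg0 (j + 1) (by omega), sub_zero, norm_zero]
  calc ∑ j ∈ Ico 1 U, ‖g (j + 1) - g j‖ = ∑ j ∈ (Ico 1 U).filter (· ∈ Icc 1 X), ‖g (j + 1) - g j‖ := by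
        rw [← sum_filter_add_sum_filter_not (Ico 1 U) (· ∈ Icc 1 X)]
        rw [sum_eq_zero (s := (Ico 1 U).filter (fun j => ¬ j ∈ Icc 1 X)) fun j hj => by
          rw [mem_filter] at hj; exact hzero j hj.1 hj.2, add_zero]
    _ ≤ ∑ j ∈ Icc 1 X, ‖g (j + 1) - g j‖ :=
        sum_le_sum_of_subset_of_nonneg (fun j hj => (mem_filter.mp hj).2) fun _ _ _ => norm_nonneg _
    _ = ∑ y ∈ Icc 1 X, ‖g y - g (y + 1)‖ := sum_congr rfl fun j _ => norm_sub_rev _ _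

/-- **The sum over primes of `S(c)`** (§25: "The inner sum over primes in `S(c)` may be estimated
using Theorem 2^ψ"): for `1 ≤ z ≤ x`, a weight `g` vanishing beyond `X` with `|g| ≤ 1`,
`‖Σ_{z ≤ p ≤ x, p prime} [P ≤ p] g(c'p) λ(c'p)‖ ≤ 2 (F_ψ x^ϑ + 2 T₂ √x log x) · (V(g) + 4)/log 2`
(Abel summation with the weight `[P ≤ n] g(c'n)/log n` against `[n prime] log n · λ(c'n)`, whose
partial sums are bounded by Theorem 2^ψ and Chebyshev's bound for the prime powers).
[cite: FriedlanderIwaniecAnnals1998, §25 (the bound for `S(c)`)] -/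
theorem norm_primeSum_le {d : ℕ} (χ : MulChar (GaussQuot (4 * d)) ℂ) (k : ℤ) {c' : ℕ} (hc' : 1 ≤ c')
    {ϑ Fψ : ℝ} (hϑ : 0 ≤ ϑ) (hF : 0 ≤ Fψ)
    (hψ : ∀ t : ℝ, 2 ≤ t → ‖vonMangoldtEigenSum d χ k c' t‖ ≤ Fψ * t ^ ϑ)
    {X x : ℕ} (hx : 1 ≤ x) (g : ℕ → ℂ) (hg0 : ∀ n, X < n → g n = 0) (hg1 : ∀ n, ‖g n‖ ≤ 1)
    {T₂ : ℝ} (hT₂ : ∀ n, 1 ≤ n → n ≤ x → ‖quadEigenvalue d χ k (c' * n)‖ ≤ T₂) (P : ℝ)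
    {z : ℕ} (hz : 1 ≤ z) (hzx : z ≤ x) :
    ‖∑ p ∈ primesIcc z x, (if P ≤ (p : ℝ) then g (c' * p) * quadEigenvalue d χ k (c' * p) else 0)‖ ≤
      2 * (Fψ * (x : ℝ) ^ ϑ + T₂ * (2 * Real.sqrt x * Real.log x)) * ((weightVariation g X + 4) / Real.log 2) := by
  have hlog2 : 0 < Real.log 2 := Real.log_pos (by norm_num)
  -- the weight and the summand
  set w : ℕ → ℂ := fun n => (if P ≤ (n : ℝ) then (1 : ℂ) else 0) * g (c' * n) *
    (((Real.log (n : ℝ))⁻¹ : ℝ) : ℂ) with hw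
  set u : ℕ → ℂ := fun n => if n.Prime then ((Real.log n : ℝ) : ℂ) * quadEigenvalue d χ k (c' * n) else 0
    with hu
  -- Step 1: rewrite the sum as `Σ_{n ∈ Ioc (z-1) x} w n * u n`
  have hrw : ∑ p ∈ primesIcc z x, (if P ≤ (p : ℝ) then g (c' * p) * quadEigenvalue d χ k (c' * p) else 0) =
      ∑ n ∈ Ioc (z - 1) x, w n * u n := by
    rw [primesIcc, sum_filter]
    have : Icc z x = Ioc (z - 1) x := by ext n; simp only [mem_Icc, mem_Ioc]; omega
    rw [this]
    refine sum_congr rfl fun n hn => ?_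
    rw [hw, hu]
    simp only
    by_cases hp : n.Prime
    · rw [if_pos hp]
      have hlogn : Real.log (n : ℝ) ≠ 0 := by
        have : (2 : ℝ) ≤ n := by exact_mod_cast hp.two_le
        exact (Real.log_pos (by linarith)).ne'
      split_ifs with hP
      · rw [one_mul]
        calc g (c' * n) * quadEigenvalue d χ k (c' * n)
            = g (c' * n) * ((((Real.log (n : ℝ))⁻¹ : ℝ) : ℂ) * ((Real.log n : ℝ) : ℂ)) *
                quadEigenvalue d χ k (c' * n) := by
              rw [← Complex.ofReal_mul, inv_mul_cancel₀ hlogn]; push_cast; ring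
          _ = _ := by ring
      · ring
    · rw [if_neg hp]; split_ifs <;> ring
  rw [hrw]
  -- Step 2: the partial sums of `u`
  set F : ℝ := Fψ * (x : ℝ) ^ ϑ + T₂ * (2 * Real.sqrt x * Real.log x) with hFdef
  have hΘ : ∀ t, t ≤ x → ‖∑ n ∈ Ioc 0 t, u n‖ ≤ F := fun t ht =>
    norm_sum_prime_log_mul_le χ k hϑ hF hψ hx hT₂ ht
  have hF0 : 0 ≤ F := le_trans (norm_nonneg _) (hΘ 0 (Nat.zero_le x))
  have hpartial : ∀ t, z - 1 ≤ t → t ≤ x → ‖∑ n ∈ Ioc (z - 1) t, u n‖ ≤ 2 * F := by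
    intro t ht1 ht2
    have hsplit := sum_Ioc_consecutive u (Nat.zero_le (z - 1)) ht1
    have : ∑ n ∈ Ioc (z - 1) t, u n = ∑ n ∈ Ioc 0 t, u n - ∑ n ∈ Ioc 0 (z - 1), u n := by
      rw [← hsplit]; ring
    rw [this]
    calc ‖∑ n ∈ Ioc 0 t, u n - ∑ n ∈ Ioc 0 (z - 1), u n‖
        ≤ ‖∑ n ∈ Ioc 0 t, u n‖ + ‖∑ n ∈ Ioc 0 (z - 1), u n‖ := norm_sub_le _ _
      _ ≤ F + F := add_le_add (hΘ t ht2) (hΘ (z - 1) (by omega))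
      _ = 2 * F := by ring
  -- Step 3: Abel summation
  have habel := norm_sum_Ioc_mul_le_of_partial w u (A := z - 1) (B := x) (by omega) hpartial
  refine habel.trans (mul_le_mul_of_nonneg_left ?_ (by positivity))
  -- Step 4: `‖w x‖ ≤ 1/log 2` and the variation of `w`
  have hwbound : ∀ n, ‖w n‖ ≤ 1 / Real.log 2 := by
    intro n
    rw [hw]; simp only
    rw [norm_mul, norm_mul]
    have h1 : ‖(if P ≤ (n : ℝ) then (1 : ℂ) else 0)‖ ≤ 1 := by split_ifs <;> simp
    have h3 : ‖(((Real.log (n : ℝ))⁻¹ : ℝ) : ℂ)‖ ≤ 1 / Real.log 2 := by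
      rw [Complex.norm_real, Real.norm_eq_abs]
      rcases lt_or_ge n 2 with hn | hn
      · interval_cases n <;> simp [hlog2.le]
      · have hn2 : (2 : ℝ) ≤ n := by exact_mod_cast hn
        have hlogn : 0 < Real.log (n : ℝ) := Real.log_pos (by linarith)
        rw [abs_of_pos (inv_pos.mpr hlogn), one_div]
        exact inv_anti₀ hlog2 (Real.log_le_log (by norm_num) hn2)
    calc ‖(if P ≤ (n : ℝ) then (1 : ℂ) else 0)‖ * ‖g (c' * n)‖ * ‖(((Real.log (n : ℝ))⁻¹ : ℝ) : ℂ)‖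
        ≤ 1 * 1 * (1 / Real.log 2) := mul_le_mul (mul_le_mul h1 (hg1 _) (norm_nonneg _) zero_le_one) h3
          (norm_nonneg _) (by norm_num)
      _ = 1 / Real.log 2 := by ring
  have hvar : ∑ n ∈ Ioo (z - 1) x, ‖w (n + 1) - w n‖ ≤ (weightVariation g X + 3) / Real.log 2 := by
    -- three-term splitting of the difference
    set ρ' : ℕ → ℂ := fun n => if P ≤ (n : ℝ) then (1 : ℂ) else 0 with hρ
    set G : ℕ → ℂ := fun n => g (c' * n) with hG
    set L : ℕ → ℂ := fun n => (((Real.log (n : ℝ))⁻¹ : ℝ) : ℂ) with hL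
    have hwn : ∀ n, w n = ρ' n * G n * L n := fun n => rfl
    have hρ1 : ∀ n, ‖ρ' n‖ ≤ 1 := fun n => by rw [hρ]; simp only; split_ifs <;> simp
    have hG1 : ∀ n, ‖G n‖ ≤ 1 := fun n => hg1 _
    have hL1 : ∀ n, 1 ≤ n → ‖L (n + 1)‖ ≤ 1 / Real.log 2 := by
      intro n hn
      rw [hL]; simp only
      rw [Complex.norm_real, Real.norm_eq_abs]
      have hn2 : (2 : ℝ) ≤ ((n + 1 : ℕ) : ℝ) := by push_cast; exact_mod_cast (by omega : 2 ≤ n + 1)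
      have hlogn : 0 < Real.log ((n + 1 : ℕ) : ℝ) := Real.log_pos (by linarith)
      rw [abs_of_pos (inv_pos.mpr hlogn), one_div]
      exact inv_anti₀ hlog2 (Real.log_le_log (by norm_num) hn2)
    have hdiff : ∀ n, 1 ≤ n → ‖w (n + 1) - w n‖ ≤
        ‖ρ' (n + 1) - ρ' n‖ * (1 / Real.log 2) + ‖G (n + 1) - G n‖ * (1 / Real.log 2) + ‖L (n + 1) - L n‖ := by
      intro n hn
      rw [hwn, hwn]
      have hid : ρ' (n + 1) * G (n + 1) * L (n + 1) - ρ' n * G n * L n =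
          (ρ' (n + 1) - ρ' n) * G (n + 1) * L (n + 1) + ρ' n * (G (n + 1) - G n) * L (n + 1) +
            ρ' n * G n * (L (n + 1) - L n) := by ring
      rw [hid]
      refine (norm_add₃_le).trans (add_le_add (add_le_add ?_ ?_) ?_)
      · rw [norm_mul, norm_mul, mul_assoc]
        refine mul_le_mul_of_nonneg_left ?_ (norm_nonneg _)
        calc ‖G (n + 1)‖ * ‖L (n + 1)‖ ≤ 1 * (1 / Real.log 2) :=
              mul_le_mul (hG1 _) (hL1 n hn) (norm_nonneg _) zero_le_one
          _ = 1 / Real.log 2 := one_mul _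
      · rw [norm_mul, norm_mul]
        calc ‖ρ' n‖ * ‖G (n + 1) - G n‖ * ‖L (n + 1)‖ ≤ 1 * ‖G (n + 1) - G n‖ * (1 / Real.log 2) :=
              mul_le_mul (mul_le_mul_of_nonneg_right (hρ1 n) (norm_nonneg _)) (hL1 n hn) (norm_nonneg _)
                (by positivity)
          _ = ‖G (n + 1) - G n‖ * (1 / Real.log 2) := by ring
      · rw [norm_mul, norm_mul]
        calc ‖ρ' n‖ * ‖G n‖ * ‖L (n + 1) - L n‖ ≤ 1 * 1 * ‖L (n + 1) - L n‖ :=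
              mul_le_mul_of_nonneg_right (mul_le_mul (hρ1 n) (hG1 n) (norm_nonneg _) zero_le_one) (norm_nonneg _)
          _ = ‖L (n + 1) - L n‖ := by ring
    have hsub : Ioo (z - 1) x ⊆ Ico 1 x := fun n hn => by
      rw [mem_Ioo] at hn; rw [mem_Ico]; omega
    calc ∑ n ∈ Ioo (z - 1) x, ‖w (n + 1) - w n‖ ≤ ∑ n ∈ Ico 1 x, ‖w (n + 1) - w n‖ :=
          sum_le_sum_of_subset_of_nonneg hsub fun _ _ _ => norm_nonneg _
      _ ≤ ∑ n ∈ Ico 1 x, (‖ρ' (n + 1) - ρ' n‖ * (1 / Real.log 2) + ‖G (n + 1) - G n‖ * (1 / Real.log 2) +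
            ‖L (n + 1) - L n‖) := sum_le_sum fun n hn => hdiff n (mem_Ico.mp hn).1
      _ = (∑ n ∈ Ico 1 x, ‖ρ' (n + 1) - ρ' n‖) * (1 / Real.log 2) +
            (∑ n ∈ Ico 1 x, ‖G (n + 1) - G n‖) * (1 / Real.log 2) + ∑ n ∈ Ico 1 x, ‖L (n + 1) - L n‖ := by
          rw [sum_add_distrib, sum_add_distrib, sum_mul, sum_mul]
      _ ≤ 1 * (1 / Real.log 2) + weightVariation g X * (1 / Real.log 2) + 2 / Real.log 2 := by
          refine add_le_add (add_le_add ?_ ?_) ?_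
          · refine mul_le_mul_of_nonneg_right ?_ (by positivity)
            have := sum_norm_indicator_step_le P (Ico 1 x)
            refine le_trans (le_of_eq (sum_congr rfl fun n _ => ?_)) this
            rw [hρ]
          · refine mul_le_mul_of_nonneg_right ?_ (by positivity)
            have hv := variation_comp_mul_le g (q := c') (Y := x) (U := c' * x) hc' le_rfl
            refine le_trans (le_of_eq (sum_congr rfl fun n _ => by rw [hG])) (hv.trans ?_)
            exact sum_Ico_norm_sub_le_weightVariation g hg0 _
          · have := sum_norm_inv_log_step_le x
            refine le_trans (le_of_eq (sum_congr rfl fun n _ => ?_)) this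
            rw [hL]
      _ = (weightVariation g X + 3) / Real.log 2 := by ring
  calc ‖w x‖ + ∑ n ∈ Ioo (z - 1) x, ‖w (n + 1) - w n‖
      ≤ 1 / Real.log 2 + (weightVariation g X + 3) / Real.log 2 := add_le_add (hwbound x) hvar
    _ = (weightVariation g X + 4) / Real.log 2 := by ring

/-- For a prime `p`: `κ_c(p) = -[p ∤ c] [P ≤ p]`. [cite: FriedlanderIwaniecAnnals1998, §25] -/
theorem coefC_prime (c : ℕ) (P : ℝ) {p : ℕ} (hp : p.Prime) :
    coefC c P p = -((if ¬ p ∣ c then (1 : ℂ) else 0) * (if P ≤ (p : ℝ) then 1 else 0)) := by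
  unfold coefC
  rw [roughInd_prime P hp, ArithmeticFunction.moebius_apply_prime hp]
  have : Nat.Coprime c p ↔ ¬ p ∣ c := by rw [Nat.coprime_comm]; exact hp.coprime_iff_not_dvd
  by_cases h : p ∣ c
  · rw [if_neg (fun h' => this.mp h' h), if_neg (not_not.mpr h)]; simp
  · rw [if_pos (this.mpr h), if_pos h]; push_cast; ring

/-- **The piece `S(c)`** (§25: "`S(c) = Σ_{q ≤ N^{1/r²} < p} μ(q) g(cpq) λ(cpq)` … may be estimated
using Theorem 2^ψ … `S(c) ≪ Σ_{q ≤ N^{1/r²}} c d(|k|+1) q N^{76/77}`"): for `1 ≤ c ≤ X`, `x = X/c`,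
`1 ≤ z ≤ x`, the third sum of Proposition 24.2 applied to `f_c` has norm at most
`z · (2 (C_ψ (cz) d(|k|+1) x^ϑ + 2 T₂ √x log x) (V(g)+4)/log 2 + c T₂)`, given Theorem 2^ψ with exponent
`ϑ` and constant `C_ψ`, and a bound `|λ(m)| ≤ T₂` for `m ≤ czx` (the primes `p ∣ c` are estimated
trivially). [cite: FriedlanderIwaniecAnnals1998, §25 (the bound for `S(c)`)] -/
theorem norm_sigma3_le {d : ℕ} (hd : 1 ≤ d) (χ : MulChar (GaussQuot (4 * d)) ℂ) (k : ℤ) {X c : ℕ}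
    (hc : 1 ≤ c) (hcX : c ≤ X) (g : ℕ → ℂ) (hg0 : ∀ n, X < n → g n = 0) (hg1 : ∀ n, ‖g n‖ ≤ 1)
    (P : ℝ) {z : ℕ} (hz : 1 ≤ z) (hzx : z ≤ X / c) {ϑ Cψ : ℝ} (hϑ : 0 ≤ ϑ) (hCψ : 0 ≤ Cψ)
    (hψ : ∀ c' : ℕ, 1 ≤ c' → ∀ t : ℝ, 2 ≤ t →
      ‖vonMangoldtEigenSum d χ k c' t‖ ≤ Cψ * c' * (d * (|k| + 1 : ℝ)) * t ^ ϑ)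
    {T₂ : ℝ} (hT₂ : ∀ m, 1 ≤ m → m ≤ c * z * (X / c) → ‖quadEigenvalue d χ k m‖ ≤ T₂) :
    ‖∑ p ∈ primesIcc z (X / c), ∑ q ∈ (Icc 1 (X / c)).filter (· < z),
        (if p * q ∈ sqfLE (X / c) then
          coefC c P (p * q) * g (c * (p * q)) * quadEigenvalue d χ k (c * (p * q)) else 0)‖ ≤
      z * (2 * (Cψ * ((c * z : ℕ) : ℝ) * (d * (|k| + 1 : ℝ)) * ((X / c : ℕ) : ℝ) ^ ϑ +
          T₂ * (2 * Real.sqrt ((X / c : ℕ) : ℝ) * Real.log ((X / c : ℕ) : ℝ))) *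
          ((weightVariation g X + 4) / Real.log 2) + c * T₂) := by
  have _ := hd
  set x := X / c with hx
  have hx1 : 1 ≤ x := hz.trans hzx
  have hX : 1 ≤ X := hc.trans hcX
  have hlog2 : 0 < Real.log 2 := Real.log_pos (by norm_num)
  have hT0 : 0 ≤ T₂ := le_trans (norm_nonneg _) (hT₂ 1 le_rfl (Nat.mul_pos (Nat.mul_pos hc hz) hx1))
  have hf0 : (0 : ℝ) ≤ d * (|k| + 1 : ℝ) := by positivity
  have hV0 := weightVariation_nonneg g X
  set Q : Finset ℕ := (Icc 1 x).filter (· < z) with hQ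
  -- the bound for one `q`
  set Bq : ℝ := 2 * (Cψ * ((c * z : ℕ) : ℝ) * (d * (|k| + 1 : ℝ)) * (x : ℝ) ^ ϑ +
      T₂ * (2 * Real.sqrt x * Real.log x)) * ((weightVariation g X + 4) / Real.log 2) + c * T₂ with hBq
  have hBq0 : 0 ≤ Bq := by
    rw [hBq]
    have : 0 ≤ Real.log (x : ℝ) := Real.log_nonneg (by exact_mod_cast hx1)
    positivity
  rw [sum_comm]
  have hq : ∀ q ∈ Q, ‖∑ p ∈ primesIcc z x, (if p * q ∈ sqfLE x then
      coefC c P (p * q) * g (c * (p * q)) * quadEigenvalue d χ k (c * (p * q)) else 0)‖ ≤ Bq := by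
    intro q hqQ
    rw [hQ, mem_filter, mem_Icc] at hqQ
    obtain ⟨⟨hq1, -⟩, hqz⟩ := hqQ
    set c' := c * q with hc'
    have hc'1 : 1 ≤ c' := Nat.mul_pos hc hq1
    -- pointwise factorisation
    have hpt : ∀ p ∈ primesIcc z x, (if p * q ∈ sqfLE x then
        coefC c P (p * q) * g (c * (p * q)) * quadEigenvalue d χ k (c * (p * q)) else 0) =
        ((if Squarefree q then (1 : ℂ) else 0) * coefC c P q) *
          (coefC c P p * (g (c' * p) * quadEigenvalue d χ k (c' * p))) := by
      intro p hp
      rw [primesIcc, mem_filter, mem_Icc] at hp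
      obtain ⟨⟨hzp, hpx⟩, hpp⟩ := hp
      have hcop : Nat.Coprime p q := by
        rw [hpp.coprime_iff_not_dvd]
        intro h
        have := Nat.le_of_dvd (by omega) h
        omega
      have hmul : c * (p * q) = c' * p := by rw [hc']; ring
      by_cases hsq : Squarefree q
      · rw [if_pos hsq, one_mul]
        by_cases hle : p * q ≤ x
        · rw [if_pos (mem_sqfLE.mpr ⟨⟨Nat.mul_pos hpp.pos hq1, hle⟩,
            Nat.squarefree_mul_iff.mpr ⟨hcop, hpp.squarefree, hsq⟩⟩),
            coefC_mul_of_coprime c P hpp.ne_zero (by omega) hcop, hmul]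
          ring
        · push Not at hle
          rw [if_neg (fun h => by have := (mem_sqfLE.mp h).1.2; omega)]
          have hbig : X < c' * p := by
            rw [← hmul]
            have h1 : X / c < p * q := hle
            rw [Nat.div_lt_iff_lt_mul (by omega)] at h1
            calc X < p * q * c := h1
              _ = c * (p * q) := by ring
          rw [hg0 _ hbig]; ring
      · rw [if_neg hsq, if_neg (fun h => hsq (Nat.squarefree_mul_iff.mp (mem_sqfLE.mp h).2).2.2)]
        ring
    rw [sum_congr rfl hpt, ← mul_sum, norm_mul]
    have hcoefq : ‖(if Squarefree q then (1 : ℂ) else 0) * coefC c P q‖ ≤ 1 := by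
      rw [norm_mul]; exact mul_le_one₀ (by split_ifs <;> simp) (norm_nonneg _) (norm_coefC_le _ _ _)
    refine (mul_le_mul_of_nonneg_right hcoefq (norm_nonneg _)).trans ?_
    rw [one_mul]
    -- split `κ_c(p) = -[P ≤ p] + [p ∣ c][P ≤ p]`
    have hsplit : ∀ p ∈ primesIcc z x, coefC c P p * (g (c' * p) * quadEigenvalue d χ k (c' * p)) =
        -(if P ≤ (p : ℝ) then g (c' * p) * quadEigenvalue d χ k (c' * p) else 0) +
          (if p ∣ c then (if P ≤ (p : ℝ) then g (c' * p) * quadEigenvalue d χ k (c' * p) else 0) else 0) := by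
      intro p hp
      rw [primesIcc, mem_filter] at hp
      rw [coefC_prime c P hp.2]
      by_cases h1 : p ∣ c <;> by_cases h2 : P ≤ (p : ℝ) <;> simp [h1, h2]
    rw [sum_congr rfl hsplit, sum_add_distrib, sum_neg_distrib]
    refine (norm_add_le _ _).trans ?_
    rw [norm_neg, hBq]
    refine add_le_add ?_ ?_
    · -- the main prime sum, by Abel summation from Theorem 2^ψ
      have hψ' : ∀ t : ℝ, 2 ≤ t → ‖vonMangoldtEigenSum d χ k c' t‖ ≤
          (Cψ * c' * (d * (|k| + 1 : ℝ))) * t ^ ϑ := fun t ht => hψ c' hc'1 t ht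
      have hT₂' : ∀ n, 1 ≤ n → n ≤ x → ‖quadEigenvalue d χ k (c' * n)‖ ≤ T₂ := by
        intro n hn1 hnx
        refine hT₂ _ (Nat.mul_pos hc'1 hn1) ?_
        rw [hc']
        calc c * q * n ≤ c * z * n := Nat.mul_le_mul_right n (Nat.mul_le_mul_left c hqz.le)
          _ ≤ c * z * x := Nat.mul_le_mul_left _ hnx
      have hmain := norm_primeSum_le χ k hc'1 hϑ (by positivity) hψ' hx1 g hg0 hg1 hT₂' P hz hzx
      refine hmain.trans ?_
      have hcq : (Cψ * c' * (d * (|k| + 1 : ℝ))) ≤ Cψ * ((c * z : ℕ) : ℝ) * (d * (|k| + 1 : ℝ)) := by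
        have : (c' : ℝ) ≤ ((c * z : ℕ) : ℝ) := by
          rw [hc']; exact_mod_cast Nat.mul_le_mul_left c hqz.le
        gcongr
      have hxϑ : 0 ≤ (x : ℝ) ^ ϑ := by positivity
      have hlogx : 0 ≤ Real.log (x : ℝ) := Real.log_nonneg (by exact_mod_cast hx1)
      gcongr
    · -- the primes dividing `c`
      calc ‖∑ p ∈ primesIcc z x, (if p ∣ c then
            (if P ≤ (p : ℝ) then g (c' * p) * quadEigenvalue d χ k (c' * p) else 0) else 0)‖
          ≤ ∑ p ∈ primesIcc z x, (if p ∣ c then T₂ else 0) := by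
            refine (norm_sum_le _ _).trans (sum_le_sum fun p hp => ?_)
            rw [primesIcc, mem_filter, mem_Icc] at hp
            split_ifs with h1 h2
            · rw [norm_mul]
              calc ‖g (c' * p)‖ * ‖quadEigenvalue d χ k (c' * p)‖ ≤ 1 * T₂ := by
                    refine mul_le_mul (hg1 _) (hT₂ _ (Nat.mul_pos hc'1 hp.2.pos) ?_) (norm_nonneg _)
                      zero_le_one
                    rw [hc']
                    calc c * q * p ≤ c * z * p := Nat.mul_le_mul_right p (Nat.mul_le_mul_left c hqz.le)
                      _ ≤ c * z * x := Nat.mul_le_mul_left _ hp.1.2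
                _ = T₂ := one_mul _
            · rw [norm_zero]; exact hT0
            · rw [norm_zero]
        _ = T₂ * ((primesIcc z x).filter (· ∣ c)).card := by
            rw [← sum_filter, sum_const, nsmul_eq_mul, mul_comm]
        _ ≤ T₂ * c := by
            refine mul_le_mul_of_nonneg_left ?_ hT0
            have h1 : ((primesIcc z x).filter (· ∣ c)).card ≤ c.divisors.card :=
              card_le_card fun p hp => by
                rw [mem_filter] at hp
                exact Nat.mem_divisors.mpr ⟨hp.2, by omega⟩
            exact_mod_cast h1.trans (Nat.card_divisors_le_self c)
        _ = c * T₂ := mul_comm _ _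
  calc ‖∑ q ∈ Q, ∑ p ∈ primesIcc z x, (if p * q ∈ sqfLE x then
          coefC c P (p * q) * g (c * (p * q)) * quadEigenvalue d χ k (c * (p * q)) else 0)‖
      ≤ ∑ q ∈ Q, Bq := (norm_sum_le _ _).trans (sum_le_sum hq)
    _ = Q.card * Bq := by rw [sum_const, nsmul_eq_mul]
    _ ≤ z * Bq := by
        refine mul_le_mul_of_nonneg_right ?_ hBq0
        have : Q.card ≤ z := by
          calc Q.card ≤ (Ico 1 z).card := card_le_card fun q hq' => by
                  rw [hQ, mem_filter, mem_Icc] at hq'; rw [mem_Ico]; omega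
            _ = z - 1 := Nat.card_Ico 1 z
            _ ≤ z := Nat.sub_le z 1
        exact_mod_cast this

/-! ### Dyadic decomposition of a sum over a subset of `(1, 2^J]` -/

/-- A sum over `S ⊆ (U, U 2^J]` split into the dyadic blocks `(U 2^i, 2 U 2^i]`. [folklore] -/
private theorem sum_eq_sum_dyadic {M : Type*} [AddCommMonoid M] (F : ℕ → M) {S : Finset ℕ} {U J : ℕ}
    (hS : S ⊆ Ioc U (U * 2 ^ J)) :
    ∑ p ∈ S, F p = ∑ i ∈ range J, ∑ p ∈ S.filter (fun p => U * 2 ^ i < p ∧ p ≤ 2 * (U * 2 ^ i)), F p := by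
  classical
  have h1 : ∑ p ∈ S, F p = ∑ p ∈ Ioc U (U * 2 ^ J), (if p ∈ S then F p else 0) := by
    rw [← sum_filter]; congr 1; ext p; simp only [mem_filter]; exact ⟨fun h => ⟨hS h, h⟩, fun h => h.2⟩
  rw [h1, Vaughan.sum_Ioc_mul_two_pow_eq_sum]
  refine sum_congr rfl fun i _ => ?_
  rw [← sum_filter]
  congr 1
  ext p
  simp only [mem_filter, mem_Ioc]
  constructor
  · rintro ⟨⟨h1, h2⟩, h3⟩; exact ⟨h3, h1, by omega⟩
  · rintro ⟨h3, h1, h2⟩; exact ⟨⟨h1, by omega⟩, h3⟩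

/-! ### The small range: all of `S_c` for one `c ≤ C₀` -/

/-- **The inner sum `S_c` in the small range** (§25: `S^k_χ(β')`'s `c`-part decomposed by (24.13) with
`x = N` into `Σ_{𝔡 ≤ D} T(c, 𝔡) + T(c) - S(c)`, each estimated as above): for `1 ≤ c ≤ X`,
`x = X/c`, `r ≥ 2`, `1 ≤ z ≤ x` and `D` with `z^{r(r-1)} x ≤ D^r`,
`‖S_c‖ ≤ D · V log(6X) C (cD)^{1+ε} (2√x)^{1/12} x^{11/12+ε}`
`+ (log₂ x + 1) · (V log(6X) C c^{1+ε} (4x/z)^{1/12} (2x)^{11/12+ε} + 4T x/z)`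
`+ z · (2 (C_ψ (cz) d(|k|+1) x^ϑ + 2T₂ √x log x)(V+4)/log 2 + c T₂)`.
[cite: FriedlanderIwaniecAnnals1998, §25 (the bounds for `T(c,𝔡)`, `T(c)`, `S(c)`)] -/
theorem norm_innerSum_small_le {ε : ℝ} {C : ℝ} (hC0 : 0 ≤ C)
    (hC : ∀ d : ℕ, 1 ≤ d → ∀ χ : MulChar (GaussQuot (4 * d)) ℂ, ∀ k : ℤ,
      ∀ c : ℕ, 1 ≤ c → ∀ M₀ N₀ : ℕ, 1 ≤ M₀ → 1 ≤ N₀ → ∀ W Z : Finset ℕ, W ⊆ Icc 1 M₀ → Z ⊆ Icc 1 N₀ →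
        BilinBoundedBy (fun m n => quadEigenvalue d χ k (c * m * n)) W Z
          (C * (c : ℝ) ^ (1 + ε) * ((M₀ : ℝ) + N₀) ^ (1 / 12 : ℝ) * ((M₀ : ℝ) * N₀) ^ (11 / 12 + ε)))
    (hε : 0 ≤ ε)
    {d : ℕ} (hd : 1 ≤ d) (χ : MulChar (GaussQuot (4 * d)) ℂ) (k : ℤ) {X c : ℕ} (hc : 1 ≤ c)
    (hcX : c ≤ X) (g : ℕ → ℂ) (hg0 : ∀ n, X < n → g n = 0) (hg1 : ∀ n, ‖g n‖ ≤ 1) (P : ℝ)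
    {r : ℕ} (hr : 2 ≤ r) {z D : ℕ} (hz : 1 ≤ z) (hzx : z ≤ X / c) (hD1 : 1 ≤ D)
    (hD : z ^ (r * (r - 1)) * (X / c) ≤ D ^ r)
    {T : ℝ} (hT : ∀ n, 1 ≤ n → n ≤ X → ((Nat.divisors n).card : ℝ) ≤ T)
    {ϑ Cψ : ℝ} (hϑ : 0 ≤ ϑ) (hCψ : 0 ≤ Cψ)
    (hψ : ∀ c' : ℕ, 1 ≤ c' → ∀ t : ℝ, 2 ≤ t →
      ‖vonMangoldtEigenSum d χ k c' t‖ ≤ Cψ * c' * (d * (|k| + 1 : ℝ)) * t ^ ϑ)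
    {T₂ : ℝ} (hT₂ : ∀ m, 1 ≤ m → m ≤ c * z * (X / c) → ‖quadEigenvalue d χ k m‖ ≤ T₂) :
    ‖innerSum g P d χ k X c‖ ≤
      D * (weightVariation g X * Real.log (6 * X) *
        (C * ((c * D : ℕ) : ℝ) ^ (1 + ε) * (2 * Real.sqrt ((X / c : ℕ) : ℝ)) ^ (1 / 12 : ℝ) *
          ((X / c : ℕ) : ℝ) ^ (11 / 12 + ε))) +
      (Nat.log 2 (X / c) + 1 : ℕ) * (weightVariation g X * Real.log (6 * X) *
        (C * (c : ℝ) ^ (1 + ε) * (4 * ((X / c : ℕ) : ℝ) / z) ^ (1 / 12 : ℝ) *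
          (2 * ((X / c : ℕ) : ℝ)) ^ (11 / 12 + ε)) + 4 * T * ((X / c : ℕ) : ℝ) / z) +
      z * (2 * (Cψ * ((c * z : ℕ) : ℝ) * (d * (|k| + 1 : ℝ)) * ((X / c : ℕ) : ℝ) ^ ϑ +
          T₂ * (2 * Real.sqrt ((X / c : ℕ) : ℝ) * Real.log ((X / c : ℕ) : ℝ))) *
          ((weightVariation g X + 4) / Real.log 2) + c * T₂) := by
  set x := X / c with hx
  have hx1 : 1 ≤ x := hz.trans hzx
  have hX : 1 ≤ X := hc.trans hcX
  have hx0 : (0 : ℝ) < x := by exact_mod_cast hx1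
  have hz0 : (0 : ℝ) < z := by exact_mod_cast hz
  have hV0 := weightVariation_nonneg g X
  have hlog0 : 0 ≤ Real.log (6 * (X : ℝ)) := Real.log_nonneg (by
    have : (1 : ℝ) ≤ X := by exact_mod_cast hX
    linarith)
  have hT0 : 0 ≤ T := le_trans (by positivity) (hT 1 le_rfl hX)
  -- Proposition 24.2
  set f : ℕ → ℂ := fun ℓ => coefC c P ℓ * g (c * ℓ) * quadEigenvalue d χ k (c * ℓ) with hf
  have hS : innerSum g P d χ k X c = ∑ ℓ ∈ sqfLE x, f ℓ := innerSum_eq_sum_sqfLE g P d χ k X c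
  rw [hS, sum_sqfLE_eq_sepTriple_add hr hz hD f]
  refine (norm_add₃_le).trans (add_le_add (add_le_add ?_ ?_) ?_)
  · -- `Σ_{𝔡 ≤ D} T(c, 𝔡)`
    set B₁ : ℝ := weightVariation g X * Real.log (6 * X) *
        (C * ((c * D : ℕ) : ℝ) ^ (1 + ε) * (2 * Real.sqrt x) ^ (1 / 12 : ℝ) * (x : ℝ) ^ (11 / 12 + ε))
      with hB₁
    have hdd : ∀ dd ∈ Icc 1 D, ‖∑ m ∈ Icc 1 (Nat.sqrt x), ∑ n ∈ Icc 1 (Nat.sqrt x),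
        (if IsPlusAdm r dd m ∧ IsMinusAdm r dd n ∧ dd * m * n ∈ smoothSqf x z then f (dd * m * n) else 0)‖ ≤
        B₁ := by
      intro dd hddD
      rw [mem_Icc] at hddD
      have h := norm_sigma1_le hC hd χ k hc hcX g hg0 P r z (dd := dd) hddD.1
      refine h.trans ?_
      rw [hB₁]
      have hs : ((Nat.sqrt x : ℕ) : ℝ) ≤ Real.sqrt x := by
        rw [Real.le_sqrt (by positivity) (by positivity)]
        exact_mod_cast Nat.sqrt_le' x
      have hs0 : (0 : ℝ) ≤ (Nat.sqrt x : ℕ) := by positivity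
      have h1 : (((Nat.sqrt x : ℕ) : ℝ) + (Nat.sqrt x : ℕ)) ^ (1 / 12 : ℝ) ≤ (2 * Real.sqrt x) ^ (1 / 12 : ℝ) :=
        Real.rpow_le_rpow (by positivity) (by linarith) (by norm_num)
      have h2 : (((Nat.sqrt x : ℕ) : ℝ) * (Nat.sqrt x : ℕ)) ^ (11 / 12 + ε) ≤ (x : ℝ) ^ (11 / 12 + ε) :=
        Real.rpow_le_rpow (by positivity) (by exact_mod_cast Nat.sqrt_le x) (by linarith)
      have h3 : ((c * dd : ℕ) : ℝ) ^ (1 + ε) ≤ ((c * D : ℕ) : ℝ) ^ (1 + ε) :=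
        Real.rpow_le_rpow (by positivity) (by exact_mod_cast Nat.mul_le_mul_left c hddD.2) (by linarith)
      have : 0 ≤ (2 * Real.sqrt x) ^ (1 / 12 : ℝ) := by positivity
      have : 0 ≤ (x : ℝ) ^ (11 / 12 + ε) := by positivity
      gcongr
    calc ‖∑ dd ∈ Icc 1 D, ∑ m ∈ Icc 1 (Nat.sqrt x), ∑ n ∈ Icc 1 (Nat.sqrt x),
          (if IsPlusAdm r dd m ∧ IsMinusAdm r dd n ∧ dd * m * n ∈ smoothSqf x z then f (dd * m * n) else 0)‖
        ≤ ∑ dd ∈ Icc 1 D, B₁ := (norm_sum_le _ _).trans (sum_le_sum hdd)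
      _ = D * B₁ := by rw [sum_const, Nat.card_Icc, Nat.add_sub_cancel, nsmul_eq_mul]
  · -- `T(c)`: dyadic blocks in `p`
    set J := Nat.log 2 x + 1 with hJ
    have hprimes : primesIcc z x ⊆ Ioc 1 (1 * 2 ^ J) := fun p hp => by
      rw [primesIcc, mem_filter, mem_Icc] at hp
      rw [mem_Ioc, one_mul]
      exact ⟨hp.2.one_lt, hp.1.2.trans (Nat.lt_pow_succ_log_self (by norm_num) x).le⟩
    rw [sum_eq_sum_dyadic _ hprimes]
    simp only [one_mul]
    set B₂ : ℝ := weightVariation g X * Real.log (6 * X) *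
        (C * (c : ℝ) ^ (1 + ε) * (4 * (x : ℝ) / z) ^ (1 / 12 : ℝ) * (2 * (x : ℝ)) ^ (11 / 12 + ε)) +
        4 * T * (x : ℝ) / z with hB₂
    have hB₂0 : 0 ≤ B₂ := by rw [hB₂]; positivity
    have hblock : ∀ i ∈ range J, ‖∑ p ∈ (primesIcc z x).filter (fun p => 2 ^ i < p ∧ p ≤ 2 * 2 ^ i),
        ∑ q ∈ (Icc 1 x).filter (z ≤ ·), (if p * q ∈ sqfLE x then
          ((1 + roughCount z q : ℕ) : ℂ)⁻¹ * f (p * q) else 0)‖ ≤ B₂ := by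
      intro i _
      set P₁ := 2 ^ i with hP₁
      have hP₁1 : 1 ≤ P₁ := Nat.one_le_two_pow
      by_cases hsmall : 2 * P₁ < z
      · -- no primes in the block
        have : (primesIcc z x).filter (fun p => P₁ < p ∧ p ≤ 2 * P₁) = ∅ := by
          refine filter_false_of_mem fun p hp => ?_
          rw [primesIcc, mem_filter, mem_Icc] at hp
          omega
        rw [this, sum_empty, norm_zero]; exact hB₂0
      by_cases hbig : x < P₁ * z
      · -- every term vanishes: `pq > P₁ z > x`
        rw [sum_eq_zero fun p hp => sum_eq_zero fun q hq => ?_, norm_zero]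
        · exact hB₂0
        rw [mem_filter] at hp hq
        beta_reduce
        rw [if_neg]
        intro hmem
        have h1 := (mem_sqfLE.mp hmem).1.2
        have h2 : P₁ * z < p * q := by
          calc P₁ * z ≤ P₁ * q := Nat.mul_le_mul_left _ hq.2
            _ < p * q := Nat.mul_lt_mul_of_pos_right hp.2.1 (by omega)
        omega
      push Not at hsmall hbig
      have hP₁x : P₁ ≤ x := le_trans (Nat.le_mul_of_pos_right P₁ hz) hbig
      have h := norm_sigma2_block_le hC hd χ k hc hcX g hg0 hg1 P z hT hP₁1 hP₁x
      refine h.trans ?_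
      rw [hB₂]
      -- conversions
      have hP₁0 : (0 : ℝ) < P₁ := by exact_mod_cast hP₁1
      have hq1 : ((x / P₁ : ℕ) : ℝ) ≤ (x : ℝ) / P₁ := Nat.cast_div_le
      have hq2 : (x : ℝ) / P₁ ≤ 2 * x / z := by
        rw [div_le_div_iff₀ hP₁0 hz0]
        have : (z : ℝ) ≤ 2 * P₁ := by exact_mod_cast hsmall
        nlinarith
      have h2P : ((2 * P₁ : ℕ) : ℝ) ≤ 2 * x / z := by
        rw [le_div_iff₀ hz0]
        have : ((P₁ * z : ℕ) : ℝ) ≤ x := by exact_mod_cast hbig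
        push_cast at this ⊢
        nlinarith
      have hsum : ((2 * P₁ : ℕ) : ℝ) + ((x / P₁ : ℕ) : ℝ) ≤ 4 * (x : ℝ) / z := by
        have : (4 : ℝ) * x / z = 2 * x / z + 2 * x / z := by ring
        rw [this]; exact add_le_add h2P (hq1.trans hq2)
      have hprod : ((2 * P₁ : ℕ) : ℝ) * ((x / P₁ : ℕ) : ℝ) ≤ 2 * (x : ℝ) := by
        have : 2 * P₁ * (x / P₁) ≤ 2 * x := by
          rw [mul_assoc]; exact Nat.mul_le_mul_left 2 (Nat.mul_div_le x P₁)
        exact_mod_cast this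
      have hA : (((2 * P₁ : ℕ) : ℝ) + ((x / P₁ : ℕ) : ℝ)) ^ (1 / 12 : ℝ) ≤ (4 * (x : ℝ) / z) ^ (1 / 12 : ℝ) :=
        Real.rpow_le_rpow (by positivity) hsum (by norm_num)
      have hB : (((2 * P₁ : ℕ) : ℝ) * ((x / P₁ : ℕ) : ℝ)) ^ (11 / 12 + ε) ≤ (2 * (x : ℝ)) ^ (11 / 12 + ε) :=
        Real.rpow_le_rpow (by positivity) hprod (by linarith)
      have hE : 2 * T * ((x / P₁ : ℕ) : ℝ) ≤ 4 * T * (x : ℝ) / z := by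
        have := hq1.trans hq2
        calc 2 * T * ((x / P₁ : ℕ) : ℝ) ≤ 2 * T * (2 * x / z) := mul_le_mul_of_nonneg_left this (by positivity)
          _ = 4 * T * (x : ℝ) / z := by ring
      have : 0 ≤ (4 * (x : ℝ) / z) ^ (1 / 12 : ℝ) := by positivity
      have : 0 ≤ (2 * (x : ℝ)) ^ (11 / 12 + ε) := by positivity
      have : 0 ≤ C * (c : ℝ) ^ (1 + ε) := by positivity
      gcongr
    calc ‖∑ i ∈ range J, ∑ p ∈ (primesIcc z x).filter (fun p => 2 ^ i < p ∧ p ≤ 2 * 2 ^ i),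
          ∑ q ∈ (Icc 1 x).filter (z ≤ ·), (if p * q ∈ sqfLE x then
            ((1 + roughCount z q : ℕ) : ℂ)⁻¹ * f (p * q) else 0)‖
        ≤ ∑ i ∈ range J, B₂ := (norm_sum_le _ _).trans (sum_le_sum hblock)
      _ = (J : ℝ) * B₂ := by rw [sum_const, card_range, nsmul_eq_mul]
  · -- `S(c)`
    exact norm_sigma3_le hd χ k hc hcX g hg0 hg1 P hz hzx hϑ hCψ hψ hT₂

end SpinCharSum

end Literature.NumberTheory.Sieve.FriedlanderIwaniecPrimes
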